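import Mathlib.LinearAlgebra.Matrix.PosDef
import Mathlib.LinearAlgebra.Matrix.Hermitian
import Mathlib.Analysis.Matrix.Spectrum
import Mathlib.Analysis.Matrix.PosDef
import Mathlib.Analysis.SpecialFunctions.BinaryEntropy
import Mathlib.Analysis.Convex.Jensen
import Mathlib.Analysis.Complex.Order
import Mathlib.Tactic.NoncommRing
import HarnessLib

/-!
# Barrier: no pairing in generalized Hartree–Fock (BCS mean-field) theory of the repulsive Hubbard model (Bach–Lieb–Solovej 1994)

Barrier catalogue `Literature/Barriers/HubbardSuperconductivity/` (D-0021), entry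
`GeneralizedHartreeFockNoPairing`, for the summit `HubbardSuperconductivity` (`d_{x²-y²}`
pair-field long-range order of the ground states of the pure REPULSIVE Hubbard model). The
barrier: in the generalized Hartree–Fock (gHF) variational theory — energies and pressures of
quasi-free states, i.e. BCS/Bogoliubov–de Gennes mean-field theory with the BARE Hamiltonian —
a positive (semi)definite two-body interaction never profits from pairing; for the repulsive
Hubbard interaction "Theorem 2.11 applies. Hence, we may restrict our attention to 1-pdm of the
form `Γ = diag(γ, 1 - γ̄)`" (BLS §IV.a). Everything is PROVED here — the energy statements, the
entropy inequality (2c.32) of the printed proof (by Jensen on eigenvalues), and the pressure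
statements (2c.29).

## What is vendored (as printed)

* V. Bach, E. H. Lieb, J. P. Solovej, *Generalized Hartree–Fock theory and the Hubbard model*,
  J. Stat. Phys. **76** (1994) 3–89 = arXiv:cond-mat/9312044 (`BachLiebSolovej1994`, held as
  `paper:arxiv-cond-mat_9312044`). Abstract (p. 1): "The familiar unrestricted Hartree-Fock
  variational principle is generalized to include quasi-free states. ... these are in one-to-one
  correspondence with the one-particle density matrices and these, in turn provide a convenient
  formulation of a generalized Hartree-Fock variational principle, which includes the BCS theory
  as a special case. ... BCS states for the attractive model turn into usual HF states for the
  repulsive model." P. 3: "the repulsive Hubbard model at half-filling ... always has a normal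
  state as its optimal state (for zero and for positive temperature)".
  §II.b: the 1-pdm `Γ` of a state on `H ⊕ H`, Lemma 2.1 "`0 ≤ Γ ≤ 1`" (2b.3); block form
  `Γ = [[γ, α], [α†, 1 - γ̄]]` (2b.5) with `⟨f_m|γ f_k⟩ = ρ(c†_k c_m)`,
  `⟨f_m|α† f_k⟩ = ρ(c†_k c†_m)` (2b.6), `Ā` the entrywise conjugate (2b.7),
  "`γ† = γ`, `αᵀ = -α`" (2b.8); Theorem 2.3 (every such `Γ` — "admissible" — is the 1-pdm of a
  unique quasi-free state); after Lemma 2.7: "a generalized HF state with 1-pdm `Γ` has conserved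
  particle number if and only if the component `α` of `Γ` vanishes. We call a generalized HF
  state for which this holds a normal state."
  §II.c: `H = ĥ + V̂`, `ĥ = Σ h_{ij} c†_i c_j` (2c.2), `V̂ = ½ Σ V_{kl;mn} c†_k c†_l c_n c_m` (2c.3);
  the gHF functional `E(Γ) = Tr[hγ] + ½ Σ_{k,l,m,n} V_{kl;mn}(γ_{mk}γ_{nl} - γ_{ml}γ_{nk} +
  α†_{lk}α_{mn})` (2c.8) ("direct", "exchange" and "pairing" energies), `E^HF = inf{E(Γ) | Γ
  admissible}` (2c.9), the entropy `S(Γ) = -½Tr[Γ ln Γ] - ½Tr[(1 - Γ) ln(1 - Γ)]` (2c.10), the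
  pressure functional `-P_β(Γ) = E(Γ) - β⁻¹S(Γ)` (2c.11), `P^HF(β) = sup P_β` (2c.12); Theorem 2.8:
  `E^HF ≥ E^Q := inf_ρ ρ(H)` (2c.13), `P^HF(β) ≤ P^Q` (2c.14).
  **Theorem 2.11** (p. 14, preceded by "It is often stated in the literature that if the HF
  ground state is not a normal state, (i.e., it is a BCS state) the potential `V` must have a
  negative component. It is now very easy to state this precisely."): "If the operator `V` is
  positive (semi) definite on `H ⊗ H`, `E^HF = inf{E(Γ) | Γ is admissible and normal, i.e.,
  α = 0}` (2c.28). Moreover, if `V` is strictly positive (i.e., positive definite) then any ground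
  state (if it exists) must be a normal state. Likewise, we have for the pressure
  `P^HF(β) = sup{P_β(Γ) | Γ is admissible and normal}` (2c.29)." Proof: "That `V` is positive
  means that for all `g ∈ H ⊗ H` we have `Σ_{kl;mn} V_{kl;mn} ḡ_{kl} g_{mn} ≥ 0` (2c.30) ... The
  pairing energy is exactly of the form ... `≥ 0` (2c.31). Assume `Γ` is admissible with non-zero
  `α` and form a new operator `Γ̃` by replacing `α` by zero. It is clear that `Γ̃` is still
  admissible and by (2c.31) that `E(Γ̃)` is (strictly) smaller than `E(Γ)` if `V` is (strictly)
  positive. To prove the result on the pressure we notice that the 1-pdm `Γ'` obtained by changing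
  `α` to `-α` is unitarily equivalent to `Γ`. Hence, since the entropy is a concave function we
  find `S(Γ̃) = S(½Γ + ½Γ') ≥ ½S(Γ) + ½S(Γ') = S(Γ)` (2c.32)."
  §III.a: the Hubbard Hamiltonian `H_- = Σ_{x,y,σ} t_{xy} c†_{xσ}c_{yσ} - Σ_x U_x(n_{x↑} - ½)(n_{x↓}
  - ½)`, `U_x ≥ 0` (3a.1) ("if `U_x` is independent of `x` the distinction [from `U n_{x↑}n_{x↓}`]
  is unimportant"), its functional in the basis `|x, σ⟩`:
  `E(Γ) = Tr[tγ] - Σ_x U_x{[⟨x↑|γ|x↑⟩ - ½][⟨x↓|γ|x↓⟩ - ½] - |⟨x↑|γ|x↓⟩|² + |⟨x↑|α|x↓⟩|²}` (3a.7)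
  and pressure `-P_{β,μ}(Γ) = E(Γ) - β⁻¹S(Γ) - μ Tr[γ]` (3a.8)–(3a.9).
  **§IV.a** (p. 32): the repulsive model `H_+` = (3a.1) with `+U_x` (4a.1); "A close look at the
  pair interaction reveals that `c†_{x↑}c_{x↑}c†_{x↓}c_{x↓} = c†_{x↑}c†_{x↓}c_{x↓}c_{x↑} ≥ 0`. Thus
  the interaction (corresponding to the operator `V` in Chapter II) is repulsive and Theorem 2.11
  applies. Hence, we may restrict our attention to 1-pdm of the form `Γ = diag(γ, 1 - γ̄)` and
  the energy expectation reduces to `E(Γ) = Tr[T'₀γ] + Σ_x U_x{[γ_↑(x) - ½][γ_↓(x) - ½] -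
  |γ_*(x)|²}` (4a.2)".
* D. P. Arovas, E. Berg, S. A. Kivelson, S. Raghu, Ann. Rev. CMP **13** (2022) 239
  (`ArovasBergKivelsonRaghu2022`, arXiv:2103.12097), §5.1 p. 9: "When `U/t → 0-`, BCS
  mean-field theory is asymptotically exact"; p. 11: "repulsive BCS interactions (`V_ℓ > 0`)
  weaken and attractive interactions grow ... In the case of the Hubbard model, the bare repulsive
  `U` enters only the s-wave BCS channel and is orthogonal to unconventional pairing channels
  (e.g. d-wave, p-wave, etc.)"; §5.1.3 p. 13 (after the perturbative RG step generating effective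
  couplings `∝ U²/t`): "since the effective couplings are weak, this can be addressed within the
  context of BCS mean-field theory"; §5.4 pp. 18–20: the Hartree–Fock approximation "becomes
  asymptotically exact in the large-N generalization of the Hubbard model", "There have been
  numerous Hartree-Fock studies of the Hubbard model."

## Lean rendering (everything proved)

Finite one-particle spaces only (the Hubbard case of the source: "the set of admissible density
matrices is a compact subset of a finite dimensional space"). A generalized 1-pdm is a pair of
matrices `GHFState ι := (γ, α)` over an orbital index type `ι`; `GHFState.onePDM` is the block
matrix (2b.5) on `ι ⊕ ι` (`γ̄ = (γᵀ)ᴴ`); `IsAdmissible` = (2b.8) ∧ `0 ≤ Γ ≤ 1`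
(Mathlib `Matrix.PosSemidef`); `IsNormal` = "`α = 0`"; `normalPart` = `Γ̃`.
* `GHFState.energy h V Γ` = (2c.8) verbatim (complex-valued); `twoBodyForm`, `TwoBodyNonneg`
  (2c.30), `TwoBodyPos`; `isAdmissible_normalPart` ("`Γ̃` is still admissible", by compressing
  `0 ≤ Γ` and `0 ≤ 1 - Γ` to the diagonal blocks); `energy_eq_normalPart_add` (energy = normal
  part + pairing energy (2c.31)); **Theorem 2.11**: `energy_normalPart_le`,
  `exists_normal_energy_le`, `ghfEnergyInf_eq_normalInf` (= (2c.28), `E^HF` as an `sInf` in `ℝ`),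
  `isGroundState_normalPart`, and the strict part `isNormal_of_isGroundState`; entropy (2c.10) via
  eigenvalues (`GHFState.entropy`, Mathlib `Real.binEntropy`); the entropy step (2c.32)
  `entropy_le_entropy_normalPart` PROVED (`sum_binEntropy_eigenvalues_le_of_two_smul_eq`: with
  `Γ = U diag(μ) U⋆`, `Γ̃ = V diag(ν) V⋆`, `2Γ̃ = Γ + DΓD⋆` for the parity `D = diag(1, -1)`
  (`two_smul_onePDM_normalPart`), `2ν_i = Σ_j μ_j(|W₁{}_{ji}|² + |W₂{}_{ji}|²)` for the unitaries
  `W₁ = U⋆V`, `W₂ = U⋆D⋆V`, and concavity of `η` — Mathlib `Real.strictConcave_binEntropy`,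
  `ConcaveOn.le_map_sum` — with unit row/column sums); `negPressure` (2c.11),
  `negPressure_normalPart_le` and **(2c.29)** `ghfPressureSup_eq_normalSup`; the named-fact form
  `entropy_normalPart_ge` is kept for users and discharged (`entropy_normalPart_ge_holds`).
* The repulsive Hubbard model (orbitals `Λ × Fin 2`, spin `0 = ↑`, `1 = ↓`):
  `hubbardGHFEnergy t U Γ` = (3a.7) with `+U_x` ((4a.1); real-valued), its splitting
  `hubbardGHFEnergy_eq_normalPart_add` (pairing energy `Σ_x U_x |α(x↑, x↓)|²`),
  **§IV.a**: `hubbardGHFEnergy_normalPart_le`, `hubbardGHFInf_eq_normalInf`,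
  `isHubbardGHFGroundState_normalPart`, `onSitePairing_eq_zero_of_isHubbardGHFGroundState`
  (`U_x > 0`), `hubbardGHFNegPressure_normalPart_le`, `hubbardGHFPressureSup_eq_normalSup`
  ((3a.9) = sup over normal states), and the barrier:
  technique class `PairingLowersGHFEnergy` (some paired quasi-free state beats every normal one —
  FALSE for `U_x ≥ 0`, `not_pairingLowersGHFEnergy`), headline `GeneralizedHartreeFockNoPairing`
  with `generalizedHartreeFockNoPairing_holds`.
* Audit section (2026-08-14): the strict clause does NOT extend off-site — `AllHubbardGHFGroundStatesNormal`
  ("every gHF ground state of a strictly repulsive Hubbard model is normal") is refuted by an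
  explicit two-site witness at the atomic band-bottom onset (`offSiteWitness`,
  `hubbardGHFEnergy_atomicOnset_ge`, `isHubbardGHFGroundState_offSiteWitness`,
  `not_allHubbardGHFGroundStatesNormal`); such paired ground states only tie with normal ones.
  Part 2: `GHFState.isNormal_of_isAdmissible_of_γ_mul_self` (idempotent `γ` forces `α = 0`) and
  `isNormal_of_isHubbardGHFGroundState_of_slater` (closed HF shells ⇒ every gHF ground state normal).
* Second audit pass (2026-08-14, barrier audit of the companion `…Proofs.lean`): at POSITIVE
  temperature the off-site loophole is absent — strict concavity of the entropy makes every gHF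
  Gibbs state (`0 < T < ∞`) normal for any `U_x ≥ 0` (recorded, with the printed continuum analogue
  of Hainzl–Hamza–Seiringer–Solovej, in `scope_caveats`; not formalised); the exact (iff) closing
  condition of the `T = 0` loophole is recorded there too. Docstring-only; no declaration changed.
* Third audit pass (2026-08-15, `provefact` on `AllHubbardGHFGroundStatesNormal`): that `Prop` is
  refuted in this file, hence has no discharge; it MIS-STATES Theorem 2.11, whose strict clause is
  printed for positive DEFINITE `V` only. The corrected statements are vendored under new names and
  discharged (section "Audit, part 3"): `GHFGroundStatesNormalOfTwoBodyPos` (the strict clause as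
  printed), `AllHubbardGHFGroundStatesOnSiteNormal` (Hubbard, `U_x > 0`: on-site amplitudes vanish),
  and the positive-temperature statement announced in the second pass, now PROVED:
  `GHFState.eq_of_sum_binEntropy_eigenvalues_eq` (equality case of the eigenvalue Jensen argument),
  `GHFState.entropy_lt_entropy_normalPart` (the entropy step (2c.32) is strict when `α ≠ 0`),
  `GHFState.IsGibbsState` / `IsHubbardGHFGibbsState` (pressure minimisers, BLS p. 12),
  `GHFState.isNormal_of_isGibbsState`, `isNormal_of_isHubbardGHFGibbsState`, the named fact
  `AllHubbardGHFGibbsStatesNormal` with `AllHubbardGHFGibbsStatesNormal_holds` (every gHF Gibbs state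
  of `H_+`, `U_x ≥ 0`, `0 < β`, any `t`, `μ`, is normal), and non-vacuity
  (`isHubbardGHFGibbsState_maximallyMixed`).
* Verdict clean-up (2026-08-16): `AllHubbardGHFGroundStatesNormal` — misstated (Theorem 2.11's
  strict clause is printed for positive DEFINITE `V` only, p. 14; the Hubbard `V` is semidefinite,
  §IV.a p. 32) and refuted in this file — now carries `@[deprecated]`: it is no longer a named fact
  awaiting discharge. Its statement is kept byte-for-byte under its ledger-referenced name, only
  because its refutation `not_allHubbardGHFGroundStatesNormal` names it (human ruling 2026-08-15 on
  misstated facts: restate, do not delete; the linter `deprecated` is switched off for that one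
  theorem). The corrected statements are the three discharged ones of the third pass
  (`AllHubbardGHFGroundStatesOnSiteNormal`, `GHFGroundStatesNormalOfTwoBodyPos`,
  `AllHubbardGHFGibbsStatesNormal`); nothing else changed.

## Design notes

* The printed functional (2c.8) is complex-valued; ground states minimise its real part
  (`IsGroundState`). For the Hubbard model the functional (3a.7) is transcribed directly as a
  real number (`re Tr[(t ⊕ t)γ]`, `re γ_σ(x)`, `|·|²`), which is what (3a.7) denotes for
  admissible (Hermitian) `γ`. That the Hubbard functional is the instance `V_{kl;mn}` of (2c.8) is
  the source's sentence "corresponding to the operator `V` in Chapter II"; both the general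
  theorem and its Hubbard form are proved independently (the latter is the one the barrier uses).
* For the Hubbard interaction `V` is positive SEMIdefinite, not definite: only the on-site
  amplitude `α(x↑, x↓)` enters `E`. Accordingly the proved strict statement is the vanishing of
  ON-SITE pairing in ground states for `U_x > 0`; nothing forces off-site `α` to vanish (see
  `scope_caveats`).
* `sInf` over the image of the admissible set is used for `E^HF` (2c.9); the equality with the
  normal-state infimum is proved in all cases of `ℝ`'s junk conventions
  (`sInf_image_eq_of_forall_exists_le`), so no compactness is needed.

## Mathlib / tree search

Mathlib: `Matrix.PosSemidef`, `PosSemidef.submatrix`, `posSemidef_iff_dotProduct_mulVec`,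
`Matrix.fromBlocks`, `fromBlocks_mulVec`, `IsHermitian.fromBlocks`, `IsHermitian.eigenvalues`,
`IsHermitian.spectral_theorem`, `eigenvectorUnitary`, `eigenvalues_eq`, `PosSemidef.eigenvalues_nonneg`,
`Real.binEntropy`, `Real.strictConcave_binEntropy`, `ConcaveOn.le_map_sum`,
`Real.sInf_of_not_bddBelow`, `csInf_le_csInf`, `Real.sInf_neg`; no Hartree–Fock / quasi-free-state theory
(`lean search 'HartreeFock|quasiFree|Bogoliubov'`: only docstring mentions, e.g.
`QuantumManyBody/BoseEinsteinCondensation.lean`). Tree: no gHF material; related catalogue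
entries `PerturbativeInvisibilityOfPairing.lean` (the `U → 0+` scale `exp[-1/(αρ²U²)]` is flat)
and `WeakCouplingCeiling.lean`; `KohnLuttinger.lean` (second-order pairing vertex
`U + U²χ(k + k')`, the effective interaction that evades the present barrier).

## References

* V. Bach, E. H. Lieb, J. P. Solovej, J. Stat. Phys. 76 (1994) 3–89, arXiv:cond-mat/9312044:
  abstract; p. 3; (2b.3)–(2b.8); Thm 2.3; Lemma 2.7 and the definition of normal states;
  (2c.1)–(2c.3), (2c.7)–(2c.12); Thm 2.8; Thm 2.11 with proof (2c.28)–(2c.32); (3a.1),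
  (3a.7)–(3a.9); §IV.a (4a.1)–(4a.2).
* D. P. Arovas, E. Berg, S. A. Kivelson, S. Raghu, Annu. Rev. Condens. Matter Phys. 13 (2022)
  239–274, arXiv:2103.12097: §5.1 pp. 9, 11, 13; §5.4 pp. 18–20.
* (audit) V. Bach, E. H. Lieb, J. P. Solovej, loc. cit., Theorem 2.12, Theorem 4.5, Lemma 4.2, Table 2 p. 39,
  Table 3 p. 40;
  C. V. Kraus, J. I. Cirac, New J. Phys. 12 (2010) 113004, arXiv:1005.5284, §4.2.2 p. 11
  (`KrausCirac2010`); Q.-H. Wang, Z. D. Wang, Y. Chen, F. C. Zhang, Phys. Rev. B 73 (2006) 092507,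
  arXiv:cond-mat/0506712, p. 2 (`WangWangChenZhang2006`); T. A. Maier, M. Jarrell, T. C. Schulthess,
  P. R. C. Kent, J. B. White, Phys. Rev. Lett. 95 (2005) 237001, arXiv:cond-mat/0504529, abstract
  (`MaierEtAl2005`).
* (second audit pass) C. Hainzl, E. Hamza, R. Seiringer, J. P. Solovej, *The BCS functional for
  general pair interactions*, Commun. Math. Phys. 281 (2008) 349–367, arXiv:math-ph/0703086:
  Theorem 1 (the normal state is unstable under pair formation iff `K_{β,μ} + V` has a negative
  eigenvalue), Theorem 2 and the bound `T_c ≤ ½‖V_-‖_∞`, pp. 5–6 (`HainzlHamzaSeiringerSolovej2008`;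
  cited in `scope_caveats` only).
* (third audit pass) V. Bach, E. H. Lieb, J. P. Solovej, loc. cit.: Theorem 2.11 p. 14 (strict
  clause: "if `V` is strictly positive (i.e., positive definite)"); the definition of HF Gibbs states
  after (2c.12), p. 12 ("A HF Gibbs state is defined by a 1-pdm maximizing (2c.11)"); Lemma 3.1 with
  (3b.5)–(3b.9), p. 18 ("concavity of `S` implies ... with equality if and only if `Γ̂ = Γ̃`").
-/

noncomputable section

open Matrix Finset
open scoped ComplexOrder

namespace Literature.Barriers.HubbardSuperconductivity

universe u

/-! ### Generalized one-particle density matrices (BLS §II.b) -/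

/-- A generalized one-particle density matrix (1-pdm) in block form: the pair `(γ, α)` of
matrices over the one-particle basis `ι`, `γ_{mk} = ρ(c†_k c_m)`, `(α†)_{mk} = ρ(c†_k c†_m)` — the
data of a quasi-free (generalized Hartree–Fock, BCS) state.
[cite: BachLiebSolovej1994, (2b.5)–(2b.6) and Theorem 2.3] -/
structure GHFState (ι : Type u) where
  /-- The one-particle density matrix `γ_{mk} = ρ(c†_k c_m)`. -/
  γ : Matrix ι ι ℂ
  /-- The pairing matrix, `(α†)_{mk} = ρ(c†_k c†_m)`. -/
  α : Matrix ι ι ℂ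

namespace GHFState

variable {ι : Type u} [Fintype ι] [DecidableEq ι]

/-- The 1-pdm as an operator on `H ⊕ H`: `Γ = [[γ, α], [α†, 1 - γ̄]]`, `γ̄ = (γᵀ)ᴴ` the entrywise
complex conjugate (2b.7). [cite: BachLiebSolovej1994, (2b.5) and (2b.7)] -/
def onePDM (Γ : GHFState ι) : Matrix (ι ⊕ ι) (ι ⊕ ι) ℂ :=
  fromBlocks Γ.γ Γ.α Γ.αᴴ (1 - Γ.γᵀᴴ)

/-- Admissibility of a 1-pdm: `γ† = γ`, `αᵀ = -α` (2b.8) and `0 ≤ Γ ≤ 1` on `H ⊕ H` (2b.3)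
(Loewner order: `Γ` and `1 - Γ` positive semidefinite). "We call an operator `Γ` admissible if
it satisfies the properties in Theorem 2.3". [cite: BachLiebSolovej1994, (2b.3), (2b.8) and the definition after Theorem 2.3] -/
def IsAdmissible (Γ : GHFState ι) : Prop :=
  Γ.γ.IsHermitian ∧ Γ.αᵀ = -Γ.α ∧ Γ.onePDM.PosSemidef ∧ (1 - Γ.onePDM).PosSemidef

/-- Normal states: "a generalized HF state with 1-pdm `Γ` has conserved particle number if and
only if the component `α` of `Γ` vanishes. We call a generalized HF state for which this holds a
normal state." [cite: BachLiebSolovej1994, after Lemma 2.7] -/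
def IsNormal (Γ : GHFState ι) : Prop := Γ.α = 0

/-- The normal part `Γ̃ = (γ, 0)` of `Γ = (γ, α)` ("form a new operator `Γ̃` by replacing `α` by
zero"). [cite: BachLiebSolovej1994, proof of Theorem 2.11] -/
def normalPart (Γ : GHFState ι) : GHFState ι := ⟨Γ.γ, 0⟩

omit [Fintype ι] [DecidableEq ι] in
/-- `Γ̃` keeps `γ`. [folklore] -/
@[simp] theorem normalPart_γ (Γ : GHFState ι) : Γ.normalPart.γ = Γ.γ := rfl

omit [Fintype ι] [DecidableEq ι] in
/-- `Γ̃` has `α = 0`. [folklore] -/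
@[simp] theorem normalPart_α (Γ : GHFState ι) : Γ.normalPart.α = 0 := rfl

omit [Fintype ι] [DecidableEq ι] in
/-- `Γ̃` is normal. [folklore] -/
theorem isNormal_normalPart (Γ : GHFState ι) : Γ.normalPart.IsNormal := rfl

omit [Fintype ι] [DecidableEq ι] in
/-- A normal state is its own normal part. [folklore] -/
theorem normalPart_eq_self_of_isNormal {Γ : GHFState ι} (h : Γ.IsNormal) : Γ.normalPart = Γ := by
  cases Γ
  simp only [IsNormal] at h
  simp [normalPart, h]

omit [Fintype ι] in
/-- `Γ̃ = diag(γ, 1 - γ̄)`. [cite: BachLiebSolovej1994, Remark after Theorem 2.3] -/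
theorem onePDM_normalPart (Γ : GHFState ι) :
    Γ.normalPart.onePDM = fromBlocks Γ.γ 0 0 (1 - Γ.γᵀᴴ) := by
  simp [onePDM, normalPart]

omit [DecidableEq ι] in
/-- A block-diagonal matrix with positive semidefinite diagonal blocks is positive semidefinite.
[folklore] -/
theorem posSemidef_fromBlocks_diag {A D : Matrix ι ι ℂ} (hA : A.PosSemidef) (hD : D.PosSemidef) :
    (fromBlocks A 0 0 D).PosSemidef := by
  refine PosSemidef.of_dotProduct_mulVec_nonneg (hA.1.fromBlocks (by simp) hD.1) fun x => ?_
  have hx : star x = Sum.elim (star (x ∘ Sum.inl)) (star (x ∘ Sum.inr)) := by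
    ext (i | i) <;> rfl
  rw [fromBlocks_mulVec, zero_mulVec, zero_mulVec, add_zero, zero_add, hx,
    sumElim_dotProduct_sumElim]
  exact add_nonneg (hA.dotProduct_mulVec_nonneg _) (hD.dotProduct_mulVec_nonneg _)

omit [Fintype ι] in
/-- The upper-left block of `Γ` is `γ`. [folklore] -/
theorem onePDM_submatrix_inl (Γ : GHFState ι) :
    Γ.onePDM.submatrix Sum.inl Sum.inl = Γ.γ := by
  ext i j
  simp [onePDM]

omit [Fintype ι] in
/-- The lower-right block of `Γ` is `1 - γ̄`. [folklore] -/
theorem onePDM_submatrix_inr (Γ : GHFState ι) :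
    Γ.onePDM.submatrix Sum.inr Sum.inr = 1 - Γ.γᵀᴴ := by
  ext i j
  simp [onePDM]

omit [Fintype ι] in
/-- The upper-left block of `1 - Γ` is `1 - γ`. [folklore] -/
theorem one_sub_onePDM_submatrix_inl (Γ : GHFState ι) :
    (1 - Γ.onePDM).submatrix Sum.inl Sum.inl = 1 - Γ.γ := by
  ext i j
  simp [onePDM, one_apply]

omit [Fintype ι] in
/-- The lower-right block of `1 - Γ` is `γ̄`. [folklore] -/
theorem one_sub_onePDM_submatrix_inr (Γ : GHFState ι) :
    (1 - Γ.onePDM).submatrix Sum.inr Sum.inr = Γ.γᵀᴴ := by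
  ext i j
  simp [onePDM, one_apply]

omit [Fintype ι] in
/-- `1 - Γ̃ = diag(1 - γ, γ̄)`. [folklore] -/
theorem one_sub_onePDM_normalPart (Γ : GHFState ι) :
    1 - Γ.normalPart.onePDM = fromBlocks (1 - Γ.γ) 0 0 Γ.γᵀᴴ := by
  rw [onePDM_normalPart]
  ext (i | i) (j | j) <;> simp [one_apply]

/-- **Admissibility is preserved by dropping the pairing matrix** ("It is clear that `Γ̃` is
still admissible"): `0 ≤ Γ ≤ 1` compressed to the diagonal blocks gives `0 ≤ γ ≤ 1` and
`0 ≤ γ̄ ≤ 1`, whence `0 ≤ diag(γ, 1 - γ̄) ≤ 1`. [cite: BachLiebSolovej1994, proof of Theorem 2.11 and Remark after Theorem 2.3] -/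
theorem isAdmissible_normalPart {Γ : GHFState ι} (h : Γ.IsAdmissible) :
    Γ.normalPart.IsAdmissible := by
  obtain ⟨hγ, -, hpos, hle⟩ := h
  refine ⟨hγ, by simp [normalPart], ?_, ?_⟩
  · rw [onePDM_normalPart]
    have h1 := hpos.submatrix Sum.inl
    have h2 := hpos.submatrix Sum.inr
    rw [onePDM_submatrix_inl] at h1
    rw [onePDM_submatrix_inr] at h2
    exact posSemidef_fromBlocks_diag h1 h2
  · rw [one_sub_onePDM_normalPart]
    have h1 := hle.submatrix Sum.inl
    have h2 := hle.submatrix Sum.inr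
    rw [one_sub_onePDM_submatrix_inl] at h1
    rw [one_sub_onePDM_submatrix_inr] at h2
    exact posSemidef_fromBlocks_diag h1 h2

/-! ### The generalized Hartree–Fock functional (BLS §II.c) -/

/-- The generalized Hartree–Fock energy functional of `H = Σ h_{ij} c†_i c_j + ½ Σ V_{kl;mn}
c†_k c†_l c_n c_m` in the quasi-free state with 1-pdm `Γ = (γ, α)`:
`E(Γ) = Tr[hγ] + ½ Σ_{k,l,m,n} V_{kl;mn} (γ_{mk}γ_{nl} - γ_{ml}γ_{nk} + α†_{lk}α_{mn})`
(direct, exchange and pairing energies), verbatim. [cite: BachLiebSolovej1994, (2c.8)] -/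
def energy (h : Matrix ι ι ℂ) (V : ι → ι → ι → ι → ℂ) (Γ : GHFState ι) : ℂ :=
  (h * Γ.γ).trace + (1 / 2 : ℂ) * ∑ k, ∑ l, ∑ m, ∑ n,
    V k l m n * (Γ.γ m k * Γ.γ n l - Γ.γ m l * Γ.γ n k + Γ.αᴴ l k * Γ.α m n)

/-- The two-body quadratic form of `V` on `H ⊗ H`, `g ↦ Σ_{kl;mn} V_{kl;mn} ḡ_{kl} g_{mn}`.
[cite: BachLiebSolovej1994, (2c.30)] -/
def twoBodyForm (V : ι → ι → ι → ι → ℂ) (g : Matrix ι ι ℂ) : ℂ :=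
  ∑ k, ∑ l, ∑ m, ∑ n, V k l m n * (star (g k l) * g m n)

/-- The pairing energy `½ Σ V_{kl;mn} α†_{lk} α_{mn}`, "exactly of the form (2c.30)" at `g = α`.
[cite: BachLiebSolovej1994, (2c.31)] -/
def pairingEnergy (V : ι → ι → ι → ι → ℂ) (α : Matrix ι ι ℂ) : ℂ :=
  (1 / 2 : ℂ) * twoBodyForm V α

/-- "`V` is positive (semi) definite on `H ⊗ H`": `Σ V_{kl;mn} ḡ_{kl} g_{mn} ≥ 0` for all `g`
(in `ℂ`, i.e. real and nonnegative). [cite: BachLiebSolovej1994, Theorem 2.11 and (2c.30)] -/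
def TwoBodyNonneg (V : ι → ι → ι → ι → ℂ) : Prop :=
  ∀ g : Matrix ι ι ℂ, 0 ≤ twoBodyForm V g

/-- "`V` is strictly positive (i.e., positive definite)": the form is `≥ 0` and vanishes only at
`g = 0`. [cite: BachLiebSolovej1994, Theorem 2.11 ("Strict positivity means that if g ≠ 0 then (2c.30) is a strict inequality")] -/
def TwoBodyPos (V : ι → ι → ι → ι → ℂ) : Prop :=
  TwoBodyNonneg V ∧ ∀ g : Matrix ι ι ℂ, twoBodyForm V g = 0 → g = 0

omit [DecidableEq ι] in
/-- The gHF energy is the energy of the normal part plus the pairing energy,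
`E(Γ) = E(Γ̃) + ½ Σ V α† α` (the direct and exchange terms see only `γ`).
[cite: BachLiebSolovej1994, (2c.8) and (2c.31)] -/
theorem energy_eq_normalPart_add (h : Matrix ι ι ℂ) (V : ι → ι → ι → ι → ℂ) (Γ : GHFState ι) :
    energy h V Γ = energy h V Γ.normalPart + pairingEnergy V Γ.α := by
  simp only [energy, pairingEnergy, twoBodyForm, normalPart_γ, normalPart_α,
    Matrix.zero_apply, mul_zero, add_zero, conjTranspose_apply]
  rw [add_assoc, ← mul_add, ← Finset.sum_add_distrib]
  congr 2
  refine Finset.sum_congr rfl fun k _ => ?_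
  rw [← Finset.sum_add_distrib]
  refine Finset.sum_congr rfl fun l _ => ?_
  rw [← Finset.sum_add_distrib]
  refine Finset.sum_congr rfl fun m _ => ?_
  rw [← Finset.sum_add_distrib]
  refine Finset.sum_congr rfl fun n _ => ?_
  ring

omit [DecidableEq ι] in
/-- **BLS Theorem 2.11 (energy, pointwise form).** For positive (semi)definite `V`,
`E(Γ̃) ≤ E(Γ)` ("by (2c.31) ... `E(Γ̃)` is smaller than `E(Γ)` if `V` is positive").
[cite: BachLiebSolovej1994, Theorem 2.11, proof] -/
theorem energy_normalPart_le {V : ι → ι → ι → ι → ℂ} (hV : TwoBodyNonneg V) (h : Matrix ι ι ℂ)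
    (Γ : GHFState ι) : energy h V Γ.normalPart ≤ energy h V Γ := by
  rw [energy_eq_normalPart_add h V Γ]
  refine le_add_of_nonneg_right ?_
  unfold pairingEnergy
  exact mul_nonneg (le_of_lt (by rw [one_div]; exact inv_pos.2 zero_lt_two)) (hV Γ.α)

/-- gHF ground states: admissible 1-pdm's minimising `re E` over all admissible 1-pdm's ("A
1-pdm for which the infimum (2c.9) is attained defines a HF ground state").
[cite: BachLiebSolovej1994, (2c.9) and the definition following it] -/
def IsGroundState (h : Matrix ι ι ℂ) (V : ι → ι → ι → ι → ℂ) (Γ : GHFState ι) : Prop :=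
  Γ.IsAdmissible ∧ ∀ Γ' : GHFState ι, Γ'.IsAdmissible → (energy h V Γ).re ≤ (energy h V Γ').re

/-- **BLS Theorem 2.11 (normal states suffice).** For positive (semi)definite `V`, below every
admissible `Γ` there is an admissible NORMAL `Γ'` with `E(Γ') ≤ E(Γ)` (namely `Γ̃`).
[cite: BachLiebSolovej1994, Theorem 2.11 (2c.28)] -/
theorem exists_normal_energy_le {V : ι → ι → ι → ι → ℂ} (hV : TwoBodyNonneg V) (h : Matrix ι ι ℂ)
    {Γ : GHFState ι} (hΓ : Γ.IsAdmissible) :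
    ∃ Γ' : GHFState ι, Γ'.IsAdmissible ∧ Γ'.IsNormal ∧ energy h V Γ' ≤ energy h V Γ :=
  ⟨Γ.normalPart, isAdmissible_normalPart hΓ, isNormal_normalPart Γ, energy_normalPart_le hV h Γ⟩

/-- For positive (semi)definite `V` the normal part of a gHF ground state is a (normal) gHF
ground state. [cite: BachLiebSolovej1994, Theorem 2.11] -/
theorem isGroundState_normalPart {V : ι → ι → ι → ι → ℂ} (hV : TwoBodyNonneg V) {h : Matrix ι ι ℂ}
    {Γ : GHFState ι} (hΓ : IsGroundState h V Γ) : IsGroundState h V Γ.normalPart :=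
  ⟨isAdmissible_normalPart hΓ.1, fun Γ' hΓ' =>
    ((Complex.le_def.1 (energy_normalPart_le hV h Γ)).1).trans (hΓ.2 Γ' hΓ')⟩

/-- **BLS Theorem 2.11 (strict part).** "if `V` is strictly positive (i.e., positive definite)
then any ground state (if it exists) must be a normal state."
[cite: BachLiebSolovej1994, Theorem 2.11] -/
theorem isNormal_of_isGroundState {V : ι → ι → ι → ι → ℂ} (hV : TwoBodyPos V) {h : Matrix ι ι ℂ}
    {Γ : GHFState ι} (hΓ : IsGroundState h V Γ) : Γ.IsNormal := by
  have hle := hΓ.2 _ (isAdmissible_normalPart hΓ.1)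
  rw [energy_eq_normalPart_add h V Γ, Complex.add_re] at hle
  have hp : (pairingEnergy V Γ.α).re ≤ 0 := by linarith
  have hnn : 0 ≤ pairingEnergy V Γ.α :=
    mul_nonneg (le_of_lt (by rw [one_div]; exact inv_pos.2 zero_lt_two)) (hV.1 Γ.α)
  have hzero : pairingEnergy V Γ.α = 0 :=
    le_antisymm (Complex.le_def.2 ⟨by simpa using hp,
      by simpa using ((Complex.le_def.1 hnn).2).symm⟩) hnn
  have hform : twoBodyForm V Γ.α = 0 := by
    unfold pairingEnergy at hzero
    simpa using hzero
  exact hV.2 Γ.α hform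


/-! ### `E^HF = inf over normal states` (2c.28) -/

omit [Fintype ι] [DecidableEq ι] in
/-- Infima over a set and over a dominating subset coincide (in `ℝ`, with its junk conventions for
empty or unbounded sets, in all cases). [folklore] -/
theorem sInf_image_eq_of_forall_exists_le {X : Type*} (f : X → ℝ) {S S' : Set X} (hsub : S' ⊆ S)
    (hdom : ∀ x ∈ S, ∃ x' ∈ S', f x' ≤ f x) : sInf (f '' S) = sInf (f '' S') := by
  by_cases hne : S.Nonempty
  · obtain ⟨x0, hx0⟩ := hne
    obtain ⟨x0', hx0', -⟩ := hdom x0 hx0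
    have hne' : (f '' S').Nonempty := ⟨f x0', x0', hx0', rfl⟩
    have hneS : (f '' S).Nonempty := ⟨f x0, x0, hx0, rfl⟩
    by_cases hbdd : BddBelow (f '' S)
    · have hbdd' : BddBelow (f '' S') := hbdd.mono (Set.image_mono hsub)
      apply le_antisymm
      · exact csInf_le_csInf hbdd hne' (Set.image_mono hsub)
      · refine le_csInf hneS ?_
        rintro _ ⟨x, hx, rfl⟩
        obtain ⟨x', hx', hle⟩ := hdom x hx
        exact (csInf_le hbdd' ⟨x', hx', rfl⟩).trans hle
    · have hbdd' : ¬ BddBelow (f '' S') := by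
        intro h'
        apply hbdd
        obtain ⟨b, hb⟩ := h'
        refine ⟨b, ?_⟩
        rintro _ ⟨x, hx, rfl⟩
        obtain ⟨x', hx', hle⟩ := hdom x hx
        exact (hb ⟨x', hx', rfl⟩).trans hle
      rw [Real.sInf_of_not_bddBelow hbdd, Real.sInf_of_not_bddBelow hbdd']
  · rw [Set.not_nonempty_iff_eq_empty] at hne
    have hS' : S' = ∅ := Set.subset_eq_empty hsub hne
    rw [hne, hS', Set.image_empty]

/-- The generalized Hartree–Fock energy `E^HF = inf{E(Γ) | Γ admissible}` (real parts; `sInf`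
in `ℝ`). [cite: BachLiebSolovej1994, (2c.9)] -/
def ghfEnergyInf (h : Matrix ι ι ℂ) (V : ι → ι → ι → ι → ℂ) : ℝ :=
  sInf ((fun Γ : GHFState ι => (energy h V Γ).re) '' {Γ | Γ.IsAdmissible})

/-- The normal-state (ordinary Hartree–Fock) infimum `inf{E(Γ) | Γ admissible and normal}`.
[cite: BachLiebSolovej1994, (2c.28)] -/
def ghfEnergyNormalInf (h : Matrix ι ι ℂ) (V : ι → ι → ι → ι → ℂ) : ℝ :=
  sInf ((fun Γ : GHFState ι => (energy h V Γ).re) '' {Γ | Γ.IsAdmissible ∧ Γ.IsNormal})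

/-- **BLS Theorem 2.11, eq. (2c.28).** "If the operator `V` is positive (semi) definite on
`H ⊗ H`, `E^HF = inf{E(Γ) | Γ is admissible and normal, i.e., α = 0}`."
[cite: BachLiebSolovej1994, Theorem 2.11 (2c.28)] -/
theorem ghfEnergyInf_eq_normalInf {V : ι → ι → ι → ι → ℂ} (hV : TwoBodyNonneg V) (h : Matrix ι ι ℂ) :
    ghfEnergyInf h V = ghfEnergyNormalInf h V :=
  sInf_image_eq_of_forall_exists_le _ (fun _ hΓ => hΓ.1) fun Γ hΓ =>
    ⟨Γ.normalPart, ⟨isAdmissible_normalPart hΓ, isNormal_normalPart Γ⟩,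
      (Complex.le_def.1 (energy_normalPart_le hV h Γ)).1⟩

/-! ### Entropy and pressure (2c.10)–(2c.12) -/

/-- The entropy of a quasi-free state, `S(Γ) = -½ Tr[Γ ln Γ] - ½ Tr[(1 - Γ) ln(1 - Γ)]
= ½ Σ_i η(λ_i)` over the eigenvalues `λ_i` of the Hermitian 1-pdm `Γ` on `H ⊕ H`, `η` the
binary entropy function (Mathlib `Real.binEntropy`, `η(x) = x log x⁻¹ + (1 - x) log(1 - x)⁻¹`,
`η(0) = η(1) = 0`; eigenvalues via Mathlib `IsHermitian.eigenvalues`); **junk value** `0` if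
`Γ` is not Hermitian. [cite: BachLiebSolovej1994, (2c.10)] -/
def entropy (Γ : GHFState ι) : ℝ :=
  if hΓ : Γ.onePDM.IsHermitian then (1 / 2) * ∑ i, Real.binEntropy (hΓ.eigenvalues i) else 0

/-- The entropy of a Hermitian 1-pdm, unfolded (any proof of Hermiticity may be supplied).
[folklore] -/
theorem entropy_eq (Γ : GHFState ι) (hΓ : Γ.onePDM.IsHermitian) :
    Γ.entropy = (1 / 2) * ∑ i, Real.binEntropy (hΓ.eigenvalues i) := by
  rw [entropy, dif_pos hΓ]

/-- The (negative) gHF pressure functional with chemical potential,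
`-P_{β,μ}(Γ) = E(Γ) - β⁻¹ S(Γ) - μ N(Γ)`, `N(Γ) = Tr γ` (real parts).
[cite: BachLiebSolovej1994, (2c.11) and (3a.8)] -/
def negPressure (h : Matrix ι ι ℂ) (V : ι → ι → ι → ι → ℂ) (β μ : ℝ) (Γ : GHFState ι) : ℝ :=
  (energy h V Γ).re - β⁻¹ * entropy Γ - μ * (Γ.γ.trace).re

/-! ### The entropy step (2c.32): averaging over the particle-number parity does not decrease `S` -/

/-- Diagonal entries of `Wᴴ diag(d) W`: `(Wᴴ diag(d) W)_{ii} = Σ_j d_j ‖W_{ji}‖²`. [folklore] -/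
theorem conjTranspose_mul_diagonal_mul_apply_self {m : Type*} [Fintype m] [DecidableEq m]
    (W : Matrix m m ℂ) (d : m → ℝ) (i : m) :
    (Wᴴ * (diagonal (fun j => (d j : ℂ)) * W)) i i = ∑ j, ((d j * ‖W j i‖ ^ 2 : ℝ) : ℂ) := by
  rw [Matrix.mul_apply]
  refine Finset.sum_congr rfl fun j _ => ?_
  rw [diagonal_mul, conjTranspose_apply, Complex.star_def]
  push_cast
  rw [← Complex.conj_mul']
  ring

/-- Column sums of `‖W_{ji}‖²` are `1` when `Wᴴ W = 1`. [folklore] -/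
theorem sum_sq_norm_col_eq_one {m : Type*} [Fintype m] [DecidableEq m] {W : Matrix m m ℂ}
    (hW : Wᴴ * W = 1) (i : m) : ∑ j, ‖W j i‖ ^ 2 = 1 := by
  have h := congrFun (congrFun hW i) i
  rw [Matrix.mul_apply, one_apply_eq] at h
  have h' : ∑ j, ((‖W j i‖ ^ 2 : ℝ) : ℂ) = 1 := by
    rw [← h]
    refine Finset.sum_congr rfl fun j _ => ?_
    rw [conjTranspose_apply, Complex.star_def]
    push_cast
    rw [← Complex.conj_mul']
  exact_mod_cast h'

/-- Row sums of `‖W_{ji}‖²` are `1` when `W Wᴴ = 1`. [folklore] -/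
theorem sum_sq_norm_row_eq_one {m : Type*} [Fintype m] [DecidableEq m] {W : Matrix m m ℂ}
    (hW : W * Wᴴ = 1) (j : m) : ∑ i, ‖W j i‖ ^ 2 = 1 := by
  have h := congrFun (congrFun hW j) j
  rw [Matrix.mul_apply, one_apply_eq] at h
  have h' : ∑ i, ((‖W j i‖ ^ 2 : ℝ) : ℂ) = 1 := by
    rw [← h]
    refine Finset.sum_congr rfl fun i _ => ?_
    rw [conjTranspose_apply, Complex.star_def]
    push_cast
    rw [← Complex.mul_conj']
  exact_mod_cast h'

/-- Jensen for the (concave) binary entropy against a unit-sum family of nonnegative weights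
(Mathlib `Real.strictConcave_binEntropy`, `ConcaveOn.le_map_sum`). [folklore] -/
theorem sum_mul_binEntropy_le {m : Type*} [Fintype m] {w μ : m → ℝ} (hw : ∀ j, 0 ≤ w j)
    (hsum : ∑ j, w j = 1) (hμ : ∀ j, μ j ∈ Set.Icc (0 : ℝ) 1) :
    ∑ j, w j * Real.binEntropy (μ j) ≤ Real.binEntropy (∑ j, w j * μ j) := by
  have := Real.strictConcave_binEntropy.concaveOn.le_map_sum (t := Finset.univ) (w := w) (p := μ)
    (fun j _ => hw j) hsum (fun j _ => hμ j)
  simpa only [smul_eq_mul] using this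

/-- A convex combination of points of `[0, 1]` lies in `[0, 1]`. [folklore] -/
theorem convexComb_mem_Icc {m : Type*} [Fintype m] {w μ : m → ℝ} (hw : ∀ j, 0 ≤ w j)
    (hsum : ∑ j, w j = 1) (hμ : ∀ j, μ j ∈ Set.Icc (0 : ℝ) 1) :
    ∑ j, w j * μ j ∈ Set.Icc (0 : ℝ) 1 := by
  constructor
  · exact Finset.sum_nonneg fun j _ => mul_nonneg (hw j) (hμ j).1
  · calc ∑ j, w j * μ j ≤ ∑ j, w j * 1 :=
        Finset.sum_le_sum fun j _ => mul_le_mul_of_nonneg_left (hμ j).2 (hw j)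
      _ = 1 := by rw [← Finset.sum_mul, hsum, one_mul]

/-- The eigenvalues of a matrix with `0 ≤ Γ ≤ 1` lie in `[0, 1]` (Lemma 2.1 "`0 ≤ Γ ≤ 1`" in
spectral form). [cite: BachLiebSolovej1994, Lemma 2.1 (2b.3)] -/
theorem eigenvalues_mem_Icc_of_posSemidef {m : Type*} [Fintype m] [DecidableEq m] {Γ : Matrix m m ℂ}
    (h0 : Γ.PosSemidef) (h1 : (1 - Γ).PosSemidef) (j : m) :
    h0.1.eigenvalues j ∈ Set.Icc (0 : ℝ) 1 := by
  refine ⟨h0.eigenvalues_nonneg j, ?_⟩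
  set u : m → ℂ := ⇑(h0.1.eigenvectorBasis j) with hu
  have hμ : h0.1.eigenvalues j = RCLike.re (star u ⬝ᵥ (Γ *ᵥ u)) := h0.1.eigenvalues_eq j
  have hunit : star u ⬝ᵥ u = 1 := by
    have hn := h0.1.eigenvectorBasis.orthonormal.1 j
    have hin : inner ℂ (h0.1.eigenvectorBasis j) (h0.1.eigenvectorBasis j) = (1 : ℂ) := by
      rw [inner_self_eq_norm_sq_to_K, hn]
      simp
    rw [EuclideanSpace.inner_eq_star_dotProduct, dotProduct_comm] at hin
    exact hin
  have hnn := h1.dotProduct_mulVec_nonneg u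
  rw [sub_mulVec, one_mulVec, dotProduct_sub, hunit] at hnn
  have := (Complex.le_def.1 hnn).1
  simp only [Complex.sub_re, Complex.one_re, Complex.zero_re] at this
  have hre : (star u ⬝ᵥ (Γ *ᵥ u)).re = h0.1.eigenvalues j := by
    rw [hμ]; rfl
  linarith

/-- **Averaging does not decrease the entropy** (the mechanism of (2c.32), proved by Jensen on
eigenvalues rather than by operator concavity): if `0 ≤ Γ ≤ 1`, `D` is unitary and `N` is
Hermitian with `2N = Γ + D Γ D⋆` (so `N = ½Γ + ½Γ'`, `Γ' = DΓD⋆` unitarily equivalent to `Γ`),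
then `Σ_j η(λ_j(Γ)) ≤ Σ_i η(λ_i(N))`. Proof: with `Γ = U diag(μ) U⋆`, `N = V diag(ν) V⋆`,
`W₁ = U⋆V`, `W₂ = U⋆D⋆V` unitary, `2ν_i = Σ_j μ_j|W₁{}_{ji}|² + Σ_j μ_j|W₂{}_{ji}|²`; concavity of
`η` twice (midpoint, then Jensen with the unit column sums) and the unit row sums give the claim.
[cite: BachLiebSolovej1994, (2c.32)] -/
theorem sum_binEntropy_eigenvalues_le_of_two_smul_eq {m : Type*} [Fintype m] [DecidableEq m]
    {Γ D N : Matrix m m ℂ} (h0 : Γ.PosSemidef) (h1 : (1 - Γ).PosSemidef)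
    (hD : D ∈ Matrix.unitaryGroup m ℂ) (hN : N.IsHermitian)
    (hNdef : (2 : ℂ) • N = Γ + D * Γ * star D) :
    ∑ j, Real.binEntropy (h0.1.eigenvalues j) ≤ ∑ i, Real.binEntropy (hN.eigenvalues i) := by
  -- spectral data
  set μ : m → ℝ := h0.1.eigenvalues with hμdef
  set ν : m → ℝ := hN.eigenvalues with hνdef
  set U : Matrix m m ℂ := (h0.1.eigenvectorUnitary : Matrix m m ℂ) with hUdef
  set V : Matrix m m ℂ := (hN.eigenvectorUnitary : Matrix m m ℂ) with hVdef
  have hUU : star U * U = 1 := Unitary.coe_star_mul_self _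
  have hUU' : U * star U = 1 := Unitary.coe_mul_star_self _
  have hVV : star V * V = 1 := Unitary.coe_star_mul_self _
  have hVV' : V * star V = 1 := Unitary.coe_mul_star_self _
  have hDD : star D * D = 1 := Matrix.mem_unitaryGroup_iff'.1 hD
  have hDD' : D * star D = 1 := Matrix.mem_unitaryGroup_iff.1 hD
  have hΓspec : Γ = U * diagonal (fun j => (μ j : ℂ)) * star U := by
    have := h0.1.spectral_theorem
    rw [Unitary.conjStarAlgAut_apply] at this
    exact this
  have hNspec : N = V * diagonal (fun j => (ν j : ℂ)) * star V := by
    have := hN.spectral_theorem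
    rw [Unitary.conjStarAlgAut_apply] at this
    exact this
  -- the two unitaries
  set W₁ : Matrix m m ℂ := star U * V with hW₁
  set W₂ : Matrix m m ℂ := star U * star D * V with hW₂
  have hW₁u : W₁ᴴ * W₁ = 1 := by
    rw [hW₁, ← star_eq_conjTranspose, star_mul, star_star, Matrix.mul_assoc,
      ← Matrix.mul_assoc U, hUU', Matrix.one_mul, hVV]
  have hW₁u' : W₁ * W₁ᴴ = 1 := by
    rw [hW₁, ← star_eq_conjTranspose, star_mul, star_star, Matrix.mul_assoc,
      ← Matrix.mul_assoc V, hVV', Matrix.one_mul, hUU]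
  have hW₂u : W₂ᴴ * W₂ = 1 := by
    rw [hW₂, ← star_eq_conjTranspose, star_mul, star_mul, star_star, star_star, Matrix.mul_assoc,
      Matrix.mul_assoc, ← Matrix.mul_assoc U, ← Matrix.mul_assoc U, hUU', Matrix.one_mul,
      ← Matrix.mul_assoc D, hDD', Matrix.one_mul, hVV]
  have hW₂u' : W₂ * W₂ᴴ = 1 := by
    rw [hW₂, ← star_eq_conjTranspose, star_mul, star_mul, star_star, star_star, Matrix.mul_assoc,
      Matrix.mul_assoc, ← Matrix.mul_assoc V, hVV', Matrix.one_mul, ← Matrix.mul_assoc (star D),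
      hDD, Matrix.one_mul, hUU]
  -- `V⋆ N V = diag(ν)` and `2 V⋆ N V = W₁ᴴ diag(μ) W₁ + W₂ᴴ diag(μ) W₂`
  have hdiagN : star V * N * V = diagonal (fun j => (ν j : ℂ)) := by
    calc star V * N * V = (star V * V) * diagonal (fun j => (ν j : ℂ)) * (star V * V) := by
          rw [hNspec]; noncomm_ring
      _ = diagonal (fun j => (ν j : ℂ)) := by rw [hVV, Matrix.one_mul, Matrix.mul_one]
  have hsplit : (2 : ℂ) • (star V * N * V) =
      W₁ᴴ * (diagonal (fun j => (μ j : ℂ)) * W₁) + W₂ᴴ * (diagonal (fun j => (μ j : ℂ)) * W₂) := by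
    rw [← Matrix.smul_mul, ← Matrix.mul_smul, hNdef, hΓspec, hW₁, hW₂, ← star_eq_conjTranspose,
      ← star_eq_conjTranspose, star_mul, star_star, star_mul, star_mul, star_star, star_star]
    noncomm_ring
  -- entrywise: `2 ν_i = Σ_j μ_j ‖W₁ji‖² + Σ_j μ_j ‖W₂ji‖²`
  have hνi : ∀ i, 2 * ν i = ∑ j, μ j * ‖W₁ j i‖ ^ 2 + ∑ j, μ j * ‖W₂ j i‖ ^ 2 := by
    intro i
    have h := congrFun (congrFun hsplit i) i
    rw [Matrix.smul_apply, hdiagN, diagonal_apply_eq, Matrix.add_apply,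
      conjTranspose_mul_diagonal_mul_apply_self, conjTranspose_mul_diagonal_mul_apply_self,
      smul_eq_mul] at h
    have h' : ((2 * ν i : ℝ) : ℂ) =
        ((∑ j, μ j * ‖W₁ j i‖ ^ 2 + ∑ j, μ j * ‖W₂ j i‖ ^ 2 : ℝ) : ℂ) := by
      push_cast at h ⊢
      exact h
    exact_mod_cast h'
  -- weights and points
  have hμI : ∀ j, μ j ∈ Set.Icc (0 : ℝ) 1 := eigenvalues_mem_Icc_of_posSemidef h0 h1
  have hw₁ : ∀ i j, 0 ≤ ‖W₁ j i‖ ^ 2 := fun i j => sq_nonneg _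
  have hw₂ : ∀ i j, 0 ≤ ‖W₂ j i‖ ^ 2 := fun i j => sq_nonneg _
  -- pointwise Jensen
  have hpt : ∀ i, (∑ j, ‖W₁ j i‖ ^ 2 * Real.binEntropy (μ j)) +
      (∑ j, ‖W₂ j i‖ ^ 2 * Real.binEntropy (μ j)) ≤ 2 * Real.binEntropy (ν i) := by
    intro i
    have hc₁ := sum_sq_norm_col_eq_one hW₁u i
    have hc₂ := sum_sq_norm_col_eq_one hW₂u i
    have hJ₁ := sum_mul_binEntropy_le (fun j => hw₁ i j) hc₁ hμI
    have hJ₂ := sum_mul_binEntropy_le (fun j => hw₂ i j) hc₂ hμI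
    have hm₁ := convexComb_mem_Icc (fun j => hw₁ i j) hc₁ hμI
    have hm₂ := convexComb_mem_Icc (fun j => hw₂ i j) hc₂ hμI
    have hmid : Real.binEntropy (∑ j, ‖W₁ j i‖ ^ 2 * μ j) +
        Real.binEntropy (∑ j, ‖W₂ j i‖ ^ 2 * μ j) ≤ 2 * Real.binEntropy (ν i) := by
      have h2 := Real.strictConcave_binEntropy.concaveOn.2 hm₁ hm₂
        (by norm_num : (0 : ℝ) ≤ 1 / 2) (by norm_num : (0 : ℝ) ≤ 1 / 2)
        (by norm_num : (1 / 2 : ℝ) + 1 / 2 = 1)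
      have hνeq : ν i = (1 / 2 : ℝ) * (∑ j, ‖W₁ j i‖ ^ 2 * μ j) +
          (1 / 2 : ℝ) * (∑ j, ‖W₂ j i‖ ^ 2 * μ j) := by
        have := hνi i
        have e1 : ∑ j, ‖W₁ j i‖ ^ 2 * μ j = ∑ j, μ j * ‖W₁ j i‖ ^ 2 :=
          Finset.sum_congr rfl fun j _ => mul_comm _ _
        have e2 : ∑ j, ‖W₂ j i‖ ^ 2 * μ j = ∑ j, μ j * ‖W₂ j i‖ ^ 2 :=
          Finset.sum_congr rfl fun j _ => mul_comm _ _
        rw [e1, e2]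
        linarith
      rw [hνeq]
      simp only [smul_eq_mul] at h2
      linarith
    linarith
  -- sum over `i` and swap
  have hsum := Finset.sum_le_sum fun i (_ : i ∈ Finset.univ) => hpt i
  rw [← Finset.mul_sum, Finset.sum_add_distrib] at hsum
  have hswap : ∀ (W : Matrix m m ℂ), W * Wᴴ = 1 →
      ∑ i, ∑ j, ‖W j i‖ ^ 2 * Real.binEntropy (μ j) = ∑ j, Real.binEntropy (μ j) := by
    intro W hW
    rw [Finset.sum_comm]
    refine Finset.sum_congr rfl fun j _ => ?_
    rw [← Finset.sum_mul, sum_sq_norm_row_eq_one hW j, one_mul]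
  rw [hswap W₁ hW₁u', hswap W₂ hW₂u'] at hsum
  linarith

/-- The particle-number parity `D = diag(1, -1)` on `H ⊕ H` (the unitary with `Γ' = DΓD⋆` =
"`Γ` with `α` changed to `-α`"). [cite: BachLiebSolovej1994, proof of Theorem 2.11] -/
def paritySign (ι : Type u) [DecidableEq ι] : Matrix (ι ⊕ ι) (ι ⊕ ι) ℂ :=
  fromBlocks 1 0 0 (-1)

omit [Fintype ι] in
/-- `D` is Hermitian. [folklore] -/
theorem star_paritySign : star (paritySign ι) = paritySign ι := by
  rw [paritySign, star_eq_conjTranspose, fromBlocks_conjTranspose]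
  simp

/-- `D² = 1`, so `D` is unitary. [folklore] -/
theorem paritySign_mem_unitaryGroup : paritySign ι ∈ Matrix.unitaryGroup (ι ⊕ ι) ℂ := by
  rw [Matrix.mem_unitaryGroup_iff, star_paritySign, paritySign, fromBlocks_multiply]
  simp

/-- `2Γ̃ = Γ + DΓD⋆`: the normal part is the average of `Γ` and its parity conjugate ("the
1-pdm `Γ'` obtained by changing `α` to `-α` is unitarily equivalent to `Γ`", `Γ̃ = ½Γ + ½Γ'`).
[cite: BachLiebSolovej1994, proof of Theorem 2.11 (2c.32)] -/
theorem two_smul_onePDM_normalPart (Γ : GHFState ι) :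
    (2 : ℂ) • Γ.normalPart.onePDM = Γ.onePDM + paritySign ι * Γ.onePDM * star (paritySign ι) := by
  rw [star_paritySign, onePDM_normalPart, onePDM, paritySign, fromBlocks_multiply,
    fromBlocks_multiply, fromBlocks_add, fromBlocks_smul]
  congr 1 <;> simp [two_smul]

/-- **The entropy step (2c.32), proved:** for admissible `Γ`, `S(Γ) ≤ S(Γ̃)`.
[cite: BachLiebSolovej1994, (2c.32)] -/
theorem entropy_le_entropy_normalPart {Γ : GHFState ι} (hΓ : Γ.IsAdmissible) :
    Γ.entropy ≤ Γ.normalPart.entropy := by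
  have h0 : Γ.onePDM.PosSemidef := hΓ.2.2.1
  have h1 : (1 - Γ.onePDM).PosSemidef := hΓ.2.2.2
  have hN : Γ.normalPart.onePDM.IsHermitian := (isAdmissible_normalPart hΓ).2.2.1.1
  rw [entropy_eq Γ h0.1, entropy_eq Γ.normalPart hN]
  refine mul_le_mul_of_nonneg_left ?_ (by norm_num)
  exact sum_binEntropy_eigenvalues_le_of_two_smul_eq h0 h1 paritySign_mem_unitaryGroup hN
    (two_smul_onePDM_normalPart Γ)

/-- **BLS Theorem 2.11, eq. (2c.29) (pressure, pointwise form).** For positive (semi)definite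
`V` and `β ≥ 0`, `-P_{β,μ}(Γ̃) ≤ -P_{β,μ}(Γ)` for admissible `Γ`; hence
"`P^HF(β) = sup{P_β(Γ) | Γ is admissible and normal}`".
[cite: BachLiebSolovej1994, Theorem 2.11 (2c.29) and (2c.32)] -/
theorem negPressure_normalPart_le {V : ι → ι → ι → ι → ℂ} (hV : TwoBodyNonneg V)
    (h : Matrix ι ι ℂ) {β : ℝ} (hβ : 0 ≤ β) (μ : ℝ) {Γ : GHFState ι} (hΓ : Γ.IsAdmissible) :
    negPressure h V β μ Γ.normalPart ≤ negPressure h V β μ Γ := by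
  unfold negPressure
  have hE := (Complex.le_def.1 (energy_normalPart_le hV h Γ)).1
  have hSle := entropy_le_entropy_normalPart hΓ
  have hβ' : 0 ≤ β⁻¹ := inv_nonneg.2 hβ
  have := mul_le_mul_of_nonneg_left hSle hβ'
  simp only [normalPart_γ]
  linarith

/-- `P^HF(β)` with chemical potential: `sup{P_{β,μ}(Γ) | Γ admissible}` (as `sSup` in `ℝ`).
[cite: BachLiebSolovej1994, (2c.12)] -/
def ghfPressureSup (h : Matrix ι ι ℂ) (V : ι → ι → ι → ι → ℂ) (β μ : ℝ) : ℝ :=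
  sSup ((fun Γ : GHFState ι => -negPressure h V β μ Γ) '' {Γ | Γ.IsAdmissible})

/-- The normal-state pressure supremum `sup{P_{β,μ}(Γ) | Γ admissible and normal}`.
[cite: BachLiebSolovej1994, (2c.29)] -/
def ghfPressureNormalSup (h : Matrix ι ι ℂ) (V : ι → ι → ι → ι → ℂ) (β μ : ℝ) : ℝ :=
  sSup ((fun Γ : GHFState ι => -negPressure h V β μ Γ) '' {Γ | Γ.IsAdmissible ∧ Γ.IsNormal})

omit [Fintype ι] [DecidableEq ι] in
/-- Suprema over a set and over a dominating subset coincide (in `ℝ`, all cases). [folklore] -/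
theorem sSup_image_eq_of_forall_exists_ge {X : Type*} (f : X → ℝ) {S S' : Set X} (hsub : S' ⊆ S)
    (hdom : ∀ x ∈ S, ∃ x' ∈ S', f x ≤ f x') : sSup (f '' S) = sSup (f '' S') := by
  have key := sInf_image_eq_of_forall_exists_le (fun x => -f x) hsub
    (fun x hx => by
      obtain ⟨x', hx', hle⟩ := hdom x hx
      exact ⟨x', hx', neg_le_neg hle⟩)
  have e1 : (fun x => -f x) '' S = -(f '' S) := by
    ext y; simp [Set.mem_neg, Set.mem_image, neg_eq_iff_eq_neg]
  have e2 : (fun x => -f x) '' S' = -(f '' S') := by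
    ext y; simp [Set.mem_neg, Set.mem_image, neg_eq_iff_eq_neg]
  rw [e1, e2, Real.sInf_neg, Real.sInf_neg] at key
  exact neg_injective key

/-- **BLS Theorem 2.11, eq. (2c.29).** "Likewise, we have for the pressure
`P^HF(β) = sup{P_β(Γ) | Γ is admissible and normal}`" — for positive (semi)definite `V`,
`β ≥ 0` and any chemical potential. [cite: BachLiebSolovej1994, Theorem 2.11 (2c.29)] -/
theorem ghfPressureSup_eq_normalSup {V : ι → ι → ι → ι → ℂ} (hV : TwoBodyNonneg V)
    (h : Matrix ι ι ℂ) {β : ℝ} (hβ : 0 ≤ β) (μ : ℝ) :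
    ghfPressureSup h V β μ = ghfPressureNormalSup h V β μ :=
  sSup_image_eq_of_forall_exists_ge _ (fun _ hΓ => hΓ.1) fun Γ hΓ =>
    ⟨Γ.normalPart, ⟨isAdmissible_normalPart hΓ, isNormal_normalPart Γ⟩,
      neg_le_neg (negPressure_normalPart_le hV h hβ μ hΓ)⟩

end GHFState

/-- **Named fact form of the entropy step (kept as a `Prop` for users; discharged below).**
Dropping the pairing matrix does not decrease the entropy: `S(Γ̃) ≥ S(Γ)` for admissible `Γ` —
"the 1-pdm `Γ'` obtained by changing `α` to `-α` is unitarily equivalent to `Γ`. Hence, since the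
entropy is a concave function we find `S(Γ̃) = S(½Γ + ½Γ') ≥ ½S(Γ) + ½S(Γ') = S(Γ)`."
[cite: BachLiebSolovej1994, (2c.32)] -/
def entropy_normalPart_ge : Prop :=
  ∀ {κ : Type u} [Fintype κ] [DecidableEq κ] (Γ : GHFState κ),
    Γ.IsAdmissible → Γ.entropy ≤ Γ.normalPart.entropy

/-- **Discharge of `entropy_normalPart_ge`.** [cite: BachLiebSolovej1994, (2c.32)] -/
theorem entropy_normalPart_ge_holds : entropy_normalPart_ge.{u} :=
  fun _Γ hΓ => GHFState.entropy_le_entropy_normalPart hΓ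

/-! ### The repulsive Hubbard model (BLS §III.a (3a.1), (3a.7); §IV.a (4a.1)–(4a.2)) -/

section Hubbard

open GHFState

variable {Λ : Type u} [Fintype Λ] [DecidableEq Λ]

/-- The gHF energy of the REPULSIVE Hubbard Hamiltonian
`H_+ = Σ_{x,y,σ} t_{xy} c†_{xσ} c_{yσ} + Σ_x U_x (n_{x↑} - ½)(n_{x↓} - ½)` (4a.1), `U_x ≥ 0`, in a
quasi-free state with 1-pdm `Γ = (γ, α)` over the orbital basis `|x, σ⟩`:
`E(Γ) = re Tr[(t ⊕ t) γ] + Σ_x U_x {[γ_↑(x) - ½][γ_↓(x) - ½] - |γ_*(x)|² + |α(x↑, x↓)|²}` — eq. (3a.7)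
with the sign of `U_x` reversed (`γ_σ(x) = ⟨x,σ|γ|x,σ⟩`, `γ_*(x) = ⟨x,↑|γ|x,↓⟩`, spin `0 = ↑`,
`1 = ↓`); only the ON-SITE pairing amplitude `α(x↑, x↓)` enters. Real parts are taken where (3a.7)
denotes real numbers for admissible (Hermitian) `γ`; any chemical potential is absorbed in the
diagonal of `t` (`T'_μ = (t - μ) ⊕ (t - μ)`, (4a.3)).
[cite: BachLiebSolovej1994, (3a.7), (4a.1)–(4a.3)] -/
def hubbardGHFEnergy (t : Matrix Λ Λ ℂ) (U : Λ → ℝ) (Γ : GHFState (Λ × Fin 2)) : ℝ :=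
  (∑ σ : Fin 2, ∑ x : Λ, ∑ y : Λ, t x y * Γ.γ (y, σ) (x, σ)).re +
    ∑ x : Λ, U x * (((Γ.γ (x, 0) (x, 0)).re - 1 / 2) * ((Γ.γ (x, 1) (x, 1)).re - 1 / 2)
      - ‖Γ.γ (x, 0) (x, 1)‖ ^ 2 + ‖Γ.α (x, 0) (x, 1)‖ ^ 2)

omit [DecidableEq Λ] in
/-- The repulsive Hubbard gHF energy splits as normal part plus the on-site pairing energy,
`E(Γ) = E(Γ̃) + Σ_x U_x |α(x↑, x↓)|²`. [cite: BachLiebSolovej1994, (3a.7) and (2c.31)] -/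
theorem hubbardGHFEnergy_eq_normalPart_add (t : Matrix Λ Λ ℂ) (U : Λ → ℝ)
    (Γ : GHFState (Λ × Fin 2)) :
    hubbardGHFEnergy t U Γ =
      hubbardGHFEnergy t U Γ.normalPart + ∑ x : Λ, U x * ‖Γ.α (x, 0) (x, 1)‖ ^ 2 := by
  simp only [hubbardGHFEnergy, normalPart_γ, normalPart_α, Matrix.zero_apply, norm_zero]
  rw [add_assoc, ← Finset.sum_add_distrib]
  congr 1
  refine Finset.sum_congr rfl fun x _ => ?_
  ring

omit [DecidableEq Λ] in
/-- The on-site pairing energy is nonnegative for `U_x ≥ 0` ("the interaction ... is repulsive").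
[cite: BachLiebSolovej1994, §IV.a (4a.1)] -/
theorem hubbard_pairingEnergy_nonneg {U : Λ → ℝ} (hU : ∀ x, 0 ≤ U x) (Γ : GHFState (Λ × Fin 2)) :
    0 ≤ ∑ x : Λ, U x * ‖Γ.α (x, 0) (x, 1)‖ ^ 2 :=
  Finset.sum_nonneg fun x _ => mul_nonneg (hU x) (sq_nonneg _)

omit [DecidableEq Λ] in
/-- **BLS §IV.a: Theorem 2.11 applied to the repulsive Hubbard model (pointwise form).** For
`U_x ≥ 0`, every hopping matrix `t` and every 1-pdm, `E(Γ̃) ≤ E(Γ)`: "Thus the interaction ... is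
repulsive and Theorem 2.11 applies. Hence, we may restrict our attention to 1-pdm of the form
`diag(γ, 1 - γ̄)`". [cite: BachLiebSolovej1994, §IV.a (4a.1)–(4a.2)] -/
theorem hubbardGHFEnergy_normalPart_le (t : Matrix Λ Λ ℂ) {U : Λ → ℝ} (hU : ∀ x, 0 ≤ U x)
    (Γ : GHFState (Λ × Fin 2)) : hubbardGHFEnergy t U Γ.normalPart ≤ hubbardGHFEnergy t U Γ := by
  rw [hubbardGHFEnergy_eq_normalPart_add t U Γ]
  exact le_add_of_nonneg_right (hubbard_pairingEnergy_nonneg hU Γ)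

/-- `E^HF` of the repulsive Hubbard model, `inf{E(Γ) | Γ admissible}`.
[cite: BachLiebSolovej1994, (2c.9)] -/
def hubbardGHFInf (t : Matrix Λ Λ ℂ) (U : Λ → ℝ) : ℝ :=
  sInf (hubbardGHFEnergy t U '' {Γ | Γ.IsAdmissible})

/-- The normal-state (ordinary HF, `α = 0`) infimum of the repulsive Hubbard model.
[cite: BachLiebSolovej1994, (2c.28)] -/
def hubbardGHFNormalInf (t : Matrix Λ Λ ℂ) (U : Λ → ℝ) : ℝ :=
  sInf (hubbardGHFEnergy t U '' {Γ | Γ.IsAdmissible ∧ Γ.IsNormal})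

/-- **BLS §IV.a / (2c.28) for the repulsive Hubbard model**: `E^HF = inf over normal admissible
states`, for every `t` and every `U_x ≥ 0` (any filling: no constraint on `Tr γ` is imposed; the
chemical potential enters through `t - μ`). [cite: BachLiebSolovej1994, Theorem 2.11 (2c.28) and §IV.a] -/
theorem hubbardGHFInf_eq_normalInf (t : Matrix Λ Λ ℂ) {U : Λ → ℝ} (hU : ∀ x, 0 ≤ U x) :
    hubbardGHFInf t U = hubbardGHFNormalInf t U :=
  sInf_image_eq_of_forall_exists_le _ (fun _ hΓ => hΓ.1) fun Γ hΓ =>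
    ⟨Γ.normalPart, ⟨isAdmissible_normalPart hΓ, isNormal_normalPart Γ⟩,
      hubbardGHFEnergy_normalPart_le t hU Γ⟩

/-- gHF ground states of the repulsive Hubbard model: admissible minimisers of `E` over all
admissible 1-pdm's. [cite: BachLiebSolovej1994, (2c.9)] -/
def IsHubbardGHFGroundState (t : Matrix Λ Λ ℂ) (U : Λ → ℝ) (Γ : GHFState (Λ × Fin 2)) : Prop :=
  Γ.IsAdmissible ∧ ∀ Γ' : GHFState (Λ × Fin 2), Γ'.IsAdmissible →
    hubbardGHFEnergy t U Γ ≤ hubbardGHFEnergy t U Γ'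

/-- The normal part of a gHF ground state of the repulsive Hubbard model is a (normal) gHF ground
state. [cite: BachLiebSolovej1994, Theorem 2.11 and §IV.a] -/
theorem isHubbardGHFGroundState_normalPart (t : Matrix Λ Λ ℂ) {U : Λ → ℝ} (hU : ∀ x, 0 ≤ U x)
    {Γ : GHFState (Λ × Fin 2)} (hΓ : IsHubbardGHFGroundState t U Γ) :
    IsHubbardGHFGroundState t U Γ.normalPart :=
  ⟨isAdmissible_normalPart hΓ.1, fun Γ' hΓ' =>
    (hubbardGHFEnergy_normalPart_le t hU Γ).trans (hΓ.2 Γ' hΓ')⟩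

/-- For strictly repulsive `U_x > 0`, every gHF ground state of the Hubbard model has vanishing
ON-SITE pairing amplitudes, `α(x↑, x↓) = α(x↓, x↑) = 0` (the strict clause of Theorem 2.11 in
the only channel the on-site interaction sees; by `αᵀ = -α` for the transposed entry). Derived
here. [cite: BachLiebSolovej1994, Theorem 2.11 (strict part) and (3a.7)] -/
theorem onSitePairing_eq_zero_of_isHubbardGHFGroundState (t : Matrix Λ Λ ℂ) {U : Λ → ℝ}
    (hU : ∀ x, 0 < U x) {Γ : GHFState (Λ × Fin 2)} (hΓ : IsHubbardGHFGroundState t U Γ) (x : Λ) :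
    Γ.α (x, 0) (x, 1) = 0 ∧ Γ.α (x, 1) (x, 0) = 0 := by
  have hle := hΓ.2 _ (isAdmissible_normalPart hΓ.1)
  rw [hubbardGHFEnergy_eq_normalPart_add t U Γ] at hle
  have hsum : ∑ y : Λ, U y * ‖Γ.α (y, 0) (y, 1)‖ ^ 2 = 0 :=
    le_antisymm (by linarith) (hubbard_pairingEnergy_nonneg (fun y => (hU y).le) Γ)
  have hx := (Finset.sum_eq_zero_iff_of_nonneg fun y _ =>
    mul_nonneg (hU y).le (sq_nonneg _)).1 hsum x (Finset.mem_univ x)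
  have h0 : Γ.α (x, 0) (x, 1) = 0 := by
    rcases mul_eq_zero.1 hx with h | h
    · exact absurd h (hU x).ne'
    · exact norm_eq_zero.1 (pow_eq_zero_iff two_ne_zero |>.1 h)
  refine ⟨h0, ?_⟩
  have hT := hΓ.1.2.1
  have := congrFun (congrFun hT (x, 1)) (x, 0)
  simp only [transpose_apply, Matrix.neg_apply] at this
  rw [h0] at this
  simpa using this.symm

/-- The gHF pressure functional of the repulsive Hubbard model,
`-P_{β,μ}(Γ) = E(Γ) - β⁻¹ S(Γ) - μ Tr γ`. [cite: BachLiebSolovej1994, (3a.8) with (4a.1)] -/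
def hubbardGHFNegPressure (t : Matrix Λ Λ ℂ) (U : Λ → ℝ) (β μ : ℝ) (Γ : GHFState (Λ × Fin 2)) : ℝ :=
  hubbardGHFEnergy t U Γ - β⁻¹ * Γ.entropy - μ * (Γ.γ.trace).re

/-- **(2c.29) for the repulsive Hubbard model:** at `β ≥ 0`, `U_x ≥ 0` and any chemical potential,
the normal part of an admissible 1-pdm has no smaller pressure, `-P_{β,μ}(Γ̃) ≤ -P_{β,μ}(Γ)`
("always has a normal state as its optimal state (for zero and for positive temperature)" is
printed for half filling; the domination by the normal part holds at every `μ`).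
[cite: BachLiebSolovej1994, Theorem 2.11 (2c.29), §IV.a and p. 3] -/
theorem hubbardGHFNegPressure_normalPart_le (t : Matrix Λ Λ ℂ) {U : Λ → ℝ} (hU : ∀ x, 0 ≤ U x)
    {β : ℝ} (hβ : 0 ≤ β) (μ : ℝ) {Γ : GHFState (Λ × Fin 2)} (hΓ : Γ.IsAdmissible) :
    hubbardGHFNegPressure t U β μ Γ.normalPart ≤ hubbardGHFNegPressure t U β μ Γ := by
  unfold hubbardGHFNegPressure
  have hE := hubbardGHFEnergy_normalPart_le t hU Γ
  have := mul_le_mul_of_nonneg_left (GHFState.entropy_le_entropy_normalPart hΓ) (inv_nonneg.2 hβ)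
  simp only [normalPart_γ]
  linarith

/-- `P^HF(β, μ)` of the repulsive Hubbard model, `sup{P_{β,μ}(Γ) | Γ admissible}`.
[cite: BachLiebSolovej1994, (3a.9)] -/
def hubbardGHFPressureSup (t : Matrix Λ Λ ℂ) (U : Λ → ℝ) (β μ : ℝ) : ℝ :=
  sSup ((fun Γ : GHFState (Λ × Fin 2) => -hubbardGHFNegPressure t U β μ Γ) '' {Γ | Γ.IsAdmissible})

/-- The normal-state pressure supremum of the repulsive Hubbard model.
[cite: BachLiebSolovej1994, (2c.29)] -/
def hubbardGHFPressureNormalSup (t : Matrix Λ Λ ℂ) (U : Λ → ℝ) (β μ : ℝ) : ℝ :=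
  sSup ((fun Γ : GHFState (Λ × Fin 2) => -hubbardGHFNegPressure t U β μ Γ) ''
    {Γ | Γ.IsAdmissible ∧ Γ.IsNormal})

/-- **(2c.29)/(3a.9) for the repulsive Hubbard model:** `P^HF(β, μ) = sup over normal states`,
for every `t`, `U_x ≥ 0`, `β ≥ 0`, `μ`. [cite: BachLiebSolovej1994, Theorem 2.11 (2c.29) and §IV.a] -/
theorem hubbardGHFPressureSup_eq_normalSup (t : Matrix Λ Λ ℂ) {U : Λ → ℝ} (hU : ∀ x, 0 ≤ U x)
    {β : ℝ} (hβ : 0 ≤ β) (μ : ℝ) :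
    hubbardGHFPressureSup t U β μ = hubbardGHFPressureNormalSup t U β μ :=
  GHFState.sSup_image_eq_of_forall_exists_ge _ (fun _ hΓ => hΓ.1) fun Γ hΓ =>
    ⟨Γ.normalPart, ⟨isAdmissible_normalPart hΓ, isNormal_normalPart Γ⟩,
      neg_le_neg (hubbardGHFNegPressure_normalPart_le t hU hβ μ hΓ)⟩

/-! ### The barrier -/

/-- **The technique class, explicitly: the BCS mechanism inside generalized Hartree–Fock theory of
the (repulsive) Hubbard model.** `PairingLowersGHFEnergy t U` says that SOME admissible quasi-free
state has strictly lower gHF energy (3a.7) than EVERY normal (`α = 0`) admissible state — the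
variational signature by which BCS / Bogoliubov–de Gennes mean-field theory with the bare
Hamiltonian detects superconductivity ("BCS states for the attractive model").
[cite: BachLiebSolovej1994, abstract and Theorem 2.11] -/
def PairingLowersGHFEnergy (t : Matrix Λ Λ ℂ) (U : Λ → ℝ) : Prop :=
  ∃ Γ : GHFState (Λ × Fin 2), Γ.IsAdmissible ∧
    ∀ Γ' : GHFState (Λ × Fin 2), Γ'.IsAdmissible → Γ'.IsNormal →
      hubbardGHFEnergy t U Γ < hubbardGHFEnergy t U Γ'

/-- **The technique class is empty for the repulsive model**: for `U_x ≥ 0` no paired quasi-free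
state beats all normal ones (its own normal part is a competitor).
[cite: BachLiebSolovej1994, Theorem 2.11 and §IV.a] -/
theorem not_pairingLowersGHFEnergy (t : Matrix Λ Λ ℂ) {U : Λ → ℝ} (hU : ∀ x, 0 ≤ U x) :
    ¬ PairingLowersGHFEnergy t U := by
  rintro ⟨Γ, hΓ, h⟩
  have := h Γ.normalPart (isAdmissible_normalPart hΓ) (isNormal_normalPart Γ)
  exact absurd (hubbardGHFEnergy_normalPart_le t hU Γ) (not_le.2 this)

end Hubbard

open GHFState in
/-- **BARRIER `GeneralizedHartreeFockNoPairing` (Bach–Lieb–Solovej 1994, Theorem 2.11 and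
§IV.a).** For every finite lattice `Λ`, every hopping matrix `t` (any complex self-adjoint or
not, any chemical potential absorbed in its diagonal, hence any filling) and every repulsive
on-site interaction `U_x ≥ 0`, in generalized Hartree–Fock theory of
`H_+ = Σ t_{xy} c†_{xσ}c_{yσ} + Σ_x U_x(n_{x↑} - ½)(n_{x↓} - ½)`: (1) dropping the pairing matrix of
any admissible 1-pdm keeps it admissible and does not raise the energy; (2) `E^HF = inf over
normal states` (2c.28); (3) no paired quasi-free state beats all normal ones
(`¬ PairingLowersGHFEnergy t U`); (4) the normal part of every gHF ground state is a gHF ground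
state; (5) if `U_x > 0` for all `x`, every gHF ground state has zero on-site pairing amplitudes;
(6) at every `β ≥ 0` and chemical potential `μ`, the normal part of every admissible 1-pdm has no
smaller pressure and `P^HF(β, μ) = sup over normal states` (2c.29). PROVED below
(`generalizedHartreeFockNoPairing_holds`).

technique_class: generalized-Hartree-Fock Hartree-Fock-Bogoliubov BCS-mean-field Bogoliubov-de-Gennes quasi-free-variational-states bare-interaction-mean-field self-consistent-gap-equation-with-bare-U mean-field-pairing-instability Slater-determinant-plus-pairing variational-quasi-free-upper-bound (generalized Hartree–Fock / BCS–Bogoliubov–de Gennes mean-field theory with the BARE Hamiltonian — variational energies (and pressures) over quasi-free states, parametrised by admissible 1-pdm's `Γ = (γ, α)` [cite: BachLiebSolovej1994, abstract, (2c.8)–(2c.12)], and their self-consistent gap equations; explicitly, routes whose certificate of superconductivity is `PairingLowersGHFEnergy t U` (a paired quasi-free state of lower energy than every normal one) or a gHF ground state with nonzero ON-SITE pairing `α(x↑, x↓)`, or — at `0 < T < ∞`, by strict concavity of the entropy (see `scope_caveats`; PROVED below in the third audit section, `isNormal_of_isHubbardGHFGibbsState`, `AllHubbardGHFGibbsStatesNormal_holds`)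 — a gHF Gibbs state with any `α ≠ 0` — NOT "a gHF ground state with `α ≠ 0`" in general: off-site-paired gHF ground states that tie with normal ones exist (audit section below, `not_allHubbardGHFGroundStatesNormal`); "There have been numerous Hartree-Fock studies of the Hubbard model" [cite: ArovasBergKivelsonRaghu2022, §5.4.2 p. 20])
blocks: any route to `HubbardSuperconductivity` (pure REPULSIVE model) through mean-field pairing with the bare interaction: for `U_x ≥ 0` the gHF infimum is attained over normal states, `E^HF = inf{E(Γ) | α = 0}` [cite: BachLiebSolovej1994, Theorem 2.11 (2c.28) and §IV.a ("Theorem 2.11 applies. Hence, we may restrict our attention to 1-pdm of the form diag(γ, 1 - γ̄)")], the same for the pressure at every `β < ∞` [cite: BachLiebSolovej1994, (2c.29)] (`hubbardGHFPressureSup_eq_normalSup`), on-site pairing strictly raises the energy when `U_x > 0` (`onSitePairing_eq_zero_of_isHubbardGHFGroundState`), and off-site (e.g. `d_{x²-y²}` bond) pairing amplitudes do not enter the bare functional (3a.7) at all — "the bare repulsive `U` enters only the s-wave BCS channel and is orthogonal to unconventional pairing channels (e.g. d-wave, p-wave, etc.)" [cite: ArovasBergKivelsonRaghu2022, §5.1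 p. 11]; so no quasi-free computation with the bare repulsive Hubbard Hamiltonian can exhibit an energetic preference for pairing, `s`-wave or `d`-wave (`not_pairingLowersGHFEnergy`).
because: the pairing energy `½ Σ V_{kl;mn} α†_{lk} α_{mn}` is the quadratic form of `V` at `g = α`, nonnegative for positive `V` [cite: BachLiebSolovej1994, (2c.30)–(2c.31)]; replacing `α` by `0` keeps `0 ≤ Γ ≤ 1` ("It is clear that `Γ̃` is still admissible") and removes that term, so `E(Γ̃) ≤ E(Γ)`, strictly if `V > 0` and `α ≠ 0` [cite: BachLiebSolovej1994, proof of Theorem 2.11]; for the pressure, `Γ'` (`α ↦ -α`) is unitarily equivalent to `Γ`, `Γ̃ = ½Γ + ½Γ'` and `S` is concave, `S(Γ̃) ≥ S(Γ)` [cite: BachLiebSolovej1994, (2c.32)]; for the Hubbard interaction `c†_{x↑}c_{x↑}c†_{x↓}c_{x↓} = c†_{x↑}c†_{x↓}c_{x↓}c_{x↑} ≥ 0`, and the pairing energy is `Σ_x U_x |α(x↑, x↓)|²` [cite: BachLiebSolovej1994, §IV.a (4a.1) and (3a.7)].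
evasions_known: (i) attractive interactions: for `U < 0` "BCS mean-field theory is asymptotically exact" as `U/t → 0-` [cite: ArovasBergKivelsonRaghu2022, §5.1 p. 9] and BCS states are genuine gHF minimisers of the attractive Hubbard model [cite: BachLiebSolovej1994, abstract and p. 3]; (ii) EFFECTIVE interactions: integrating out high-energy modes perturbatively generates attractive BCS couplings `∝ U²/t` in unconventional channels (Kohn–Luttinger), after which "since the effective couplings are weak, this can be addressed within the context of BCS mean-field theory" [cite: ArovasBergKivelsonRaghu2022, §5.1.3 p. 13] — tree: `KohnLuttinger.lean` (`kohnLuttingerKernel = U + U²χ`), route `WeakCouplingBCS`, and the catalogue entries `WeakCouplingCeiling`, `PerturbativeInvisibilityOfPairing` for what that route can and cannot reach; (iii) Hartree–Fock is controlled only in a large-`N` generalisation of the model [cite: ArovasBergKivelsonRaghu2022, §5.4.1 pp. 18–20]; (iv) the true ground state: `E^HF ≥ E^Q` only [cite: BachLiebSolovej1994, Theorem 2.8] — correlated (non-quasi-free) states are outside the class; (v) in particular the "mean-field" theories that DO produce `d`-wave order in repulsive models are not quasi-free theories of the bare `H`: Gutzwiller-projected BCS / renormalized mean-field theory of the `t`–`J`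 and `t`–`U`–`J` models ("The Gutzwiller projected `d`-wave BCS states appear to capture the basic features of high-`T_c` phase diagram" [cite: WangWangChenZhang2006, p. 2]; the effective `J = 4t²/U` is the strong-coupling analogue of (ii)), and cluster dynamical mean-field embeddings with exact cluster solvers ("the results are independent of the cluster size and display a finite temperature instability to d-wave superconductivity" at `U = 4t` [cite: MaierEtAl2005, abstract]); (vi) corroboration inside the class: unrestricted numerical gHF on a `10 × 10` lattice finds "for `u ∈ [0,10]` and `μ ∈ [-5,5]` ... only an unpaired phase. This is in agreement with Thm. 2.11" [cite: KrausCirac2010, §4.2.2 p. 11].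
scope_caveats: the theorem is about the gHF FUNCTIONAL, not about the Hubbard model's true ground or Gibbs states, on which it puts only the bounds `E^HF ≥ E^Q`, `P^HF ≤ P^Q` [cite: BachLiebSolovej1994, Theorem 2.8]; for the Hubbard interaction `V` is positive SEMIdefinite, so the printed strict clause ("any ground state ... must be a normal state") does NOT apply: off-site pairing amplitudes are neither penalised nor rewarded by (3a.7), and gHF ground states with `α ≠ 0` off-site are not excluded (only normal ground states are shown to exist alongside, and on-site `α` to vanish for `U_x > 0`) — indeed they EXIST at degenerate points: two sites, no hopping, `μ` at the band-bottom onset, inter-site equal-spin `α = ½`, any `U > 0` (`isHubbardGHFGroundState_offSiteWitness`, audit section; the source's symmetry tables leave the repulsive model off the half-filled bipartite case — Table 2 (real bipartite `t`) row "`μ ≠ 0`", Table 3 (real non-bipartite `t`) row "Any `μ`" — at "No results except for `U = ∞`, where spin `SU(2)` is broken but `U(1)` and spatial invariance are not" [cite: BachLiebSolovej1994, Table 2 p. 39 and Table 3 p. 40]); a paired gHF ground state forces its normal part to be a NON-pure HF minimiser, so none exist when HF shells are closed (e.g. `μ = 0`, bipartite `t`: uniqueness modulo gauge [cite: BachLiebSolovej1994,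 Theorem 4.5]); BLS's interaction is the particle–hole symmetric `U_x(n_{x↑} - ½)(n_{x↓} - ½)`, differing from `U n_{x↑}n_{x↓}` by one-body and constant terms ("if `U_x` is independent of `x` the distinction is unimportant") [cite: BachLiebSolovej1994, after (3a.1)]; gHF Gibbs states (pressure maximisers, `0 < β < ∞`): the printed (2c.32) gives only the NON-strict domination by the normal part (`hubbardGHFNegPressure_normalPart_le`), but more is true and works FOR the barrier — the entropy `Γ ↦ S(Γ) = Tr η(Γ)/2`, `η(x) = -x ln x - (1 - x) ln(1 - x)`, is STRICTLY concave on `{0 ≤ Γ ≤ 1}` (strict concavity of `η` with the equality cases of the Peierls inequality `⟨ψ, η(A)ψ⟩ ≤ η(⟨ψ, Aψ⟩)` and of Jensen), and `Γ' = DΓD⋆ ≠ Γ` exactly when `α ≠ 0`, so `S(Γ̃) = S(½Γ + ½Γ') > S(Γ)` and `-P_{β,μ}(Γ̃) < -P_{β,μ}(Γ)` whenever `α ≠ 0`: at every `0 < T < ∞` EVERY gHF Gibbs state of `H_+` (`U_x ≥ 0`, even `U ≡ 0`) is normal, off-site amplitudes included — the certificate "a gHF Gibbs state with `α ≠ 0`"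 is unavailable at positive temperature [folklore — the equality case of the concavity of `S` is used by BLS themselves in (3b.9); PROVED in this file (third audit section): `GHFState.entropy_lt_entropy_normalPart`, `GHFState.isNormal_of_isGibbsState`, `isNormal_of_isHubbardGHFGibbsState`, named fact `AllHubbardGHFGibbsStatesNormal` with `AllHubbardGHFGibbsStatesNormal_holds`]; the printed continuum analogue: for the translation-invariant BCS functional the normal state is unstable under pair formation iff `K_{β,μ} + V` has a negative eigenvalue, and `T_c ≤ ½‖V_-‖_∞`, so a pair interaction `V ≥ 0` never pairs at any `T ≥ 0` [cite: HainzlHamzaSeiringerSolovej2008, Theorem 1 and Theorem 2 with the bound following it, pp. 5–6]; finite lattices only (as in the source's Hubbard chapter); the entropy (2c.10) carries the junk value `0` off Hermitian 1-pdm's (never met for admissible ones); the barrier constrains MINIMISERS (and Gibbs states) of the quasi-free functional, not every self-consistent solution of the bare-`U` Bogoliubov–de Gennes equations — non-minimising stationary points with on-site pairing exist trivially (the maximisers of `E` over admissible `Γ` are the BCS minimisers of the attractive model `-H_+`), while a pairing INSTABILITY of an HF minimiser is excluded (`E(γ, α) = E(γ, 0) + Σ_x U_x|α(x↑,x↓)|²`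 has no `γ`–`α` cross terms); exact closing condition of the off-site loophole: `isNormal_of_isHubbardGHFGroundState_of_slater` (audit part 2) is the formalised sufficient condition; exactly, since `0 ≤ Γ ≤ 1` forces `α` to be supported on the fractional-occupation subspace `F` of `γ` (natural orbitals with occupation strictly between `0` and `1`) and `E(γ, α) = E(γ, 0) + Σ_x U_x|α(x↑, x↓)|²`, a paired gHF ground state exists iff some HF minimiser `γ` admits a nonzero antisymmetric `α` supported on `F` with `α(x↑, x↓) = 0` for all `x` — a linear condition on `Λ²F`, met in particular whenever two fractional natural orbitals `φ₁, φ₂` have an on-site-free wedge `(φ₁ ∧ φ₂)(x↑, x↓) ≡ 0` (e.g. equal spins, or a `d`-wave pair on a degenerate Fermi shell), and conversely `εα` is then admissible for small `ε` and costs nothing [folklore].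
status: established; audited 2026-08-14 (D-0021 barrier audit: semidefinite clause CONFIRMED and fully covered — the proof quantifies over every admissible `Γ`, i.e. the whole quasi-free class; technique-class wording NARROWED — the certificate "gHF ground state with `α ≠ 0`" is refuted only on-site, see `AllHubbardGHFGroundStatesNormal` / `not_allHubbardGHFGroundStatesNormal`) (theorem [cite: BachLiebSolovej1994, Theorem 2.11 and §IV.a]; PROVED in this file in full — `generalizedHartreeFockNoPairing_holds` (energies, ground states, on-site pairing, pressures); general form `GHFState.ghfEnergyInf_eq_normalInf`, `GHFState.isNormal_of_isGroundState`, `GHFState.ghfPressureSup_eq_normalSup`, entropy step `GHFState.entropy_le_entropy_normalPart`)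
[cite: BachLiebSolovej1994, Theorem 2.11 (2c.28) and §IV.a (4a.1)–(4a.2)] -/
def GeneralizedHartreeFockNoPairing : Prop :=
  ∀ {Λ : Type u} [Fintype Λ] [DecidableEq Λ] (t : Matrix Λ Λ ℂ) (U : Λ → ℝ), (∀ x, 0 ≤ U x) →
    (∀ Γ : GHFState (Λ × Fin 2), Γ.IsAdmissible →
        Γ.normalPart.IsAdmissible ∧ hubbardGHFEnergy t U Γ.normalPart ≤ hubbardGHFEnergy t U Γ) ∧
      hubbardGHFInf t U = hubbardGHFNormalInf t U ∧
      ¬ PairingLowersGHFEnergy t U ∧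
      (∀ Γ : GHFState (Λ × Fin 2),
        IsHubbardGHFGroundState t U Γ → IsHubbardGHFGroundState t U Γ.normalPart) ∧
      ((∀ x, 0 < U x) → ∀ Γ : GHFState (Λ × Fin 2), IsHubbardGHFGroundState t U Γ →
        ∀ x, Γ.α (x, 0) (x, 1) = 0 ∧ Γ.α (x, 1) (x, 0) = 0) ∧
      (∀ β μ : ℝ, 0 ≤ β →
        (∀ Γ : GHFState (Λ × Fin 2), Γ.IsAdmissible →
            hubbardGHFNegPressure t U β μ Γ.normalPart ≤ hubbardGHFNegPressure t U β μ Γ) ∧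
          hubbardGHFPressureSup t U β μ = hubbardGHFPressureNormalSup t U β μ)

open GHFState in
/-- **The barrier holds** (discharge of `GeneralizedHartreeFockNoPairing`).
[cite: BachLiebSolovej1994, Theorem 2.11 and §IV.a] -/
theorem generalizedHartreeFockNoPairing_holds : GeneralizedHartreeFockNoPairing.{u} := by
  intro Λ _ _ t U hU
  refine ⟨fun Γ hΓ => ⟨isAdmissible_normalPart hΓ, hubbardGHFEnergy_normalPart_le t hU Γ⟩,
    hubbardGHFInf_eq_normalInf t hU, not_pairingLowersGHFEnergy t hU,
    fun Γ hΓ => isHubbardGHFGroundState_normalPart t hU hΓ,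
    fun hU' Γ hΓ x => onSitePairing_eq_zero_of_isHubbardGHFGroundState t hU' hΓ x,
    fun β μ hβ => ⟨fun Γ hΓ => hubbardGHFNegPressure_normalPart_le t hU hβ μ hΓ,
      hubbardGHFPressureSup_eq_normalSup t hU hβ μ⟩⟩

/-! ### Audit (D-0021 barrier audit, 2026-08-14): the strict clause does not extend off-site

BLS Theorem 2.11 has two clauses. The SEMIdefinite clause ((2c.28)/(2c.29): normal states
suffice) is what applies to the Hubbard interaction and is proved above. The DEFINITE clause
("any ground state (if it exists) must be a normal state") does not apply: the on-site repulsion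
is blind to every pairing amplitude except `α(x↑, x↓)`. BLS record this themselves — Table 2
(real bipartite `t`, p. 39), row "`μ ≠ 0`, Repulsive interaction", and Table 3 (real
non-bipartite `t`, p. 40), row "Repulsive interaction, Any `μ`": "No results except for `U = ∞`,
where spin `SU(2)` is broken but `U(1)` and spatial invariance are not" — i.e. off the
half-filled bipartite case the breaking of the phase `U(1)` (pairing) in HF ground states of the
repulsive model is left open by the source (at `μ = 0`, bipartite `t`, Theorem 4.5 gives uniqueness modulo gauge
transformations, hence normal ground states only). Below: (i) the reading "every gHF ground
state of a strictly repulsive Hubbard model is normal" (`AllHubbardGHFGroundStatesNormal`) is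
FALSE — an explicit admissible 1-pdm with inter-site equal-spin pair amplitude `α = ½` is a gHF
ground state of the two-site model at the atomic band-bottom onset (`t = 0`, `μ = -U/2` in the
`(n - ½)(n - ½)` convention, any `U > 0`), where `E^HF = |Λ| U / 4` exactly
(`hubbardGHFEnergy_atomicOnset_ge`, `isHubbardGHFGroundState_offSiteWitness`,
`not_allHubbardGHFGroundStatesNormal`); (ii) such paired ground states only ever TIE with their
normal parts (clause (1) of the barrier), so the barrier's operative content — no ENERGETIC
preference for pairing, `¬ PairingLowersGHFEnergy` — is untouched. The same onset mechanism works
on connected graphs whose hopping matrix has a degenerate lowest level (e.g. `K₄` or a triangle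
with the frustrated sign of `t`, two equal-spin electrons half-filling the degenerate level and
paired with each other); not formalised here.
[cite: BachLiebSolovej1994, Theorem 2.11, Theorem 2.12 (strict clauses need strictly positive V), Table 2 p. 39 (row μ ≠ 0) and Table 3 p. 40 (row any μ)]
-/

section Audit

open GHFState

variable {Λ : Type u} [Fintype Λ] [DecidableEq Λ]

omit [Fintype Λ] in
/-- For an admissible 1-pdm the `2 × 2` spin block of `γ` at a site has a nonnegative
determinant: `|γ_*(x)|² ≤ γ_↑(x) γ_↓(x)` (`0 ≤ γ` compressed to `{x↑, x↓}`). [folklore] -/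
theorem sq_norm_spinFlip_le_of_isAdmissible {Γ : GHFState (Λ × Fin 2)} (hΓ : Γ.IsAdmissible)
    (x : Λ) : ‖Γ.γ (x, 0) (x, 1)‖ ^ 2 ≤ (Γ.γ (x, 0) (x, 0)).re * (Γ.γ (x, 1) (x, 1)).re := by
  have hγ : Γ.γ.PosSemidef := by
    have := hΓ.2.2.1.submatrix Sum.inl
    rwa [onePDM_submatrix_inl] at this
  have hM : (Γ.γ.submatrix (fun σ : Fin 2 => (x, σ)) (fun σ : Fin 2 => (x, σ))).PosSemidef :=
    hγ.submatrix _
  have hdet := hM.det_nonneg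
  rw [Matrix.det_fin_two] at hdet
  simp only [submatrix_apply] at hdet
  have h10 : Γ.γ (x, 1) (x, 0) = star (Γ.γ (x, 0) (x, 1)) := (hΓ.1.apply (x, 1) (x, 0)).symm
  have h00 : Γ.γ (x, 0) (x, 0) = ((Γ.γ (x, 0) (x, 0)).re : ℂ) :=
    (hΓ.1.coe_re_apply_self (x, 0)).symm
  have h11 : Γ.γ (x, 1) (x, 1) = ((Γ.γ (x, 1) (x, 1)).re : ℂ) :=
    (hΓ.1.coe_re_apply_self (x, 1)).symm
  rw [h10, h00, h11, Complex.star_def, Complex.mul_conj, Complex.normSq_eq_norm_sq] at hdet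
  have : (0 : ℂ) ≤ (((Γ.γ (x, 0) (x, 0)).re * (Γ.γ (x, 1) (x, 1)).re
      - ‖Γ.γ (x, 0) (x, 1)‖ ^ 2 : ℝ) : ℂ) := by
    push_cast
    simpa using hdet
  have := Complex.zero_le_real.1 this
  linarith

/-- **The atomic band-bottom onset.** With no hopping and chemical potential `μ = -U₀/2` in the
`(n - ½)(n - ½)` convention (`t = (U₀/2)·1`, i.e. `μ` at the lower Hubbard level), constant
`U₀ ≥ 0`, every admissible 1-pdm has `E(Γ) ≥ |Λ| U₀ / 4`:
`E(Γ) = U₀ Σ_x {γ_↑(x)γ_↓(x) - |γ_*(x)|² + |α(x↑,x↓)|² + ¼}`. [folklore] -/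
theorem hubbardGHFEnergy_atomicOnset_ge {U₀ : ℝ} (hU₀ : 0 ≤ U₀) {Γ : GHFState (Λ × Fin 2)}
    (hΓ : Γ.IsAdmissible) :
    Fintype.card Λ * U₀ / 4 ≤
      hubbardGHFEnergy ((U₀ / 2 : ℂ) • (1 : Matrix Λ Λ ℂ)) (fun _ => U₀) Γ := by
  unfold hubbardGHFEnergy
  have hkin : (∑ σ : Fin 2, ∑ x : Λ, ∑ y : Λ,
      ((U₀ / 2 : ℂ) • (1 : Matrix Λ Λ ℂ)) x y * Γ.γ (y, σ) (x, σ)).re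
      = ∑ x : Λ, (U₀ / 2) * ((Γ.γ (x, 0) (x, 0)).re + (Γ.γ (x, 1) (x, 1)).re) := by
    have : ∀ σ : Fin 2, ∀ x : Λ,
        ∑ y : Λ, ((U₀ / 2 : ℂ) • (1 : Matrix Λ Λ ℂ)) x y * Γ.γ (y, σ) (x, σ)
          = (U₀ / 2 : ℂ) * Γ.γ (x, σ) (x, σ) := by
      intro σ x
      simp [Matrix.smul_apply, Matrix.one_apply, ite_mul, Finset.sum_ite_eq]
    simp_rw [this]
    rw [Fin.sum_univ_two, ← Finset.sum_add_distrib, Complex.re_sum]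
    refine Finset.sum_congr rfl fun x _ => ?_
    simp [Complex.mul_re]
    ring
  rw [hkin, ← Finset.sum_add_distrib]
  have hsite : ∀ x : Λ, U₀ / 4 ≤ U₀ / 2 * ((Γ.γ (x, 0) (x, 0)).re + (Γ.γ (x, 1) (x, 1)).re) +
      U₀ * (((Γ.γ (x, 0) (x, 0)).re - 1 / 2) * ((Γ.γ (x, 1) (x, 1)).re - 1 / 2)
        - ‖Γ.γ (x, 0) (x, 1)‖ ^ 2 + ‖Γ.α (x, 0) (x, 1)‖ ^ 2) := by
    intro x
    have hm := sq_norm_spinFlip_le_of_isAdmissible hΓ x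
    have ha : 0 ≤ ‖Γ.α (x, 0) (x, 1)‖ ^ 2 := sq_nonneg _
    nlinarith
  calc (Fintype.card Λ : ℝ) * U₀ / 4 = ∑ _x : Λ, U₀ / 4 := by
        rw [Finset.sum_const, Finset.card_univ, nsmul_eq_mul]; ring
    _ ≤ _ := Finset.sum_le_sum fun x _ => hsite x

/-- Witness `γ` on two sites: `γ = ½` on the spin-`↑` diagonal, `0` elsewhere (each `↑` orbital
half occupied, no `↓` electrons). [folklore] -/
def offSiteWitnessγ : Matrix (Fin 2 × Fin 2) (Fin 2 × Fin 2) ℂ :=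
  Matrix.of fun i j => if i = j ∧ i.2 = 0 then 1 / 2 else 0

/-- Witness `α` on two sites: the inter-site equal-spin (triplet) pair amplitude
`α(0↑, 1↑) = -α(1↑, 0↑) = ½`, all on-site amplitudes zero. [folklore] -/
def offSiteWitnessα : Matrix (Fin 2 × Fin 2) (Fin 2 × Fin 2) ℂ :=
  Matrix.of fun i j => if i = (0, 0) ∧ j = (1, 0) then 1 / 2
    else if i = (1, 0) ∧ j = (0, 0) then -(1 / 2) else 0

/-- The off-site-paired witness 1-pdm `(γ, α)` (a pure quasi-free state: its `Γ` is a
projection). [folklore] -/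
def offSiteWitness : GHFState (Fin 2 × Fin 2) := ⟨offSiteWitnessγ, offSiteWitnessα⟩

/-- `Γ² = Γ` for the witness (pure quasi-free state). [folklore] -/
theorem offSiteWitness_onePDM_mul_self :
    offSiteWitness.onePDM * offSiteWitness.onePDM = offSiteWitness.onePDM := by
  ext i j
  rcases i with ⟨i1, i2⟩ | ⟨i1, i2⟩ <;> rcases j with ⟨j1, j2⟩ | ⟨j1, j2⟩ <;>
    fin_cases i1 <;> fin_cases i2 <;> fin_cases j1 <;> fin_cases j2 <;>
    simp [Matrix.mul_apply, Fintype.sum_sum_type, Fintype.sum_prod_type, Fin.sum_univ_two,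
      GHFState.onePDM, offSiteWitness, offSiteWitnessγ, offSiteWitnessα, fromBlocks,
      Matrix.one_apply, map_ofNat] <;> norm_num

/-- The witness `γ` is Hermitian. [folklore] -/
theorem offSiteWitness_γ_isHermitian : offSiteWitness.γ.IsHermitian := by
  ext i j
  rcases i with ⟨i1, i2⟩; rcases j with ⟨j1, j2⟩
  fin_cases i1 <;> fin_cases i2 <;> fin_cases j1 <;> fin_cases j2 <;>
    simp [offSiteWitness, offSiteWitnessγ]

/-- The witness `α` is antisymmetric. [folklore] -/
theorem offSiteWitness_α_transpose : offSiteWitness.αᵀ = -offSiteWitness.α := by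
  ext i j
  rcases i with ⟨i1, i2⟩; rcases j with ⟨j1, j2⟩
  fin_cases i1 <;> fin_cases i2 <;> fin_cases j1 <;> fin_cases j2 <;>
    simp [offSiteWitness, offSiteWitnessα]

/-- The witness `Γ` is Hermitian. [folklore] -/
theorem offSiteWitness_onePDM_isHermitian : offSiteWitness.onePDM.IsHermitian := by
  unfold GHFState.onePDM
  exact IsHermitian.fromBlocks offSiteWitness_γ_isHermitian (by simp)
    (isHermitian_one.sub offSiteWitness_γ_isHermitian.transpose.conjTranspose)

/-- The witness is admissible (`0 ≤ Γ ≤ 1` because `Γ` is an orthogonal projection).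
[folklore] -/
theorem offSiteWitness_isAdmissible : offSiteWitness.IsAdmissible := by
  have hH := offSiteWitness_onePDM_isHermitian
  have hP := offSiteWitness_onePDM_mul_self
  refine ⟨offSiteWitness_γ_isHermitian, offSiteWitness_α_transpose, ?_, ?_⟩
  · have : offSiteWitness.onePDM = offSiteWitness.onePDMᴴ * offSiteWitness.onePDM := by
      rw [hH.eq, hP]
    rw [this]
    exact posSemidef_conjTranspose_mul_self _
  · have h1 : (1 - offSiteWitness.onePDM) =
        (1 - offSiteWitness.onePDM)ᴴ * (1 - offSiteWitness.onePDM) := by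
      rw [conjTranspose_sub, conjTranspose_one, hH.eq, sub_mul, one_mul, mul_sub, mul_one, hP,
        sub_self, sub_zero]
    rw [h1]
    exact posSemidef_conjTranspose_mul_self _

/-- The witness has energy `|Λ| U₀ / 4` at the atomic onset (its `↓` orbitals are empty, its `↑`
orbitals half filled, no on-site pairing). [folklore] -/
theorem hubbardGHFEnergy_offSiteWitness (U₀ : ℝ) :
    hubbardGHFEnergy ((U₀ / 2 : ℂ) • (1 : Matrix (Fin 2) (Fin 2) ℂ)) (fun _ => U₀) offSiteWitness
      = Fintype.card (Fin 2) * U₀ / 4 := by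
  simp [hubbardGHFEnergy, Fin.sum_univ_two, offSiteWitness, offSiteWitnessγ, offSiteWitnessα,
    Matrix.smul_apply, Matrix.one_apply]
  ring

/-- The witness is not normal (`α ≠ 0`). [folklore] -/
theorem offSiteWitness_not_isNormal : ¬ offSiteWitness.IsNormal := by
  intro h
  have := congrFun (congrFun h (0, 0)) (1, 0)
  simp [offSiteWitness, offSiteWitnessα] at this

/-- **A paired gHF ground state of a strictly repulsive Hubbard model.** For every `U₀ ≥ 0` the
off-site-paired witness is a gHF ground state of the two-site model at the atomic onset
(`t = (U₀/2)·1`, `U ≡ U₀`). [folklore] -/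
theorem isHubbardGHFGroundState_offSiteWitness {U₀ : ℝ} (hU₀ : 0 ≤ U₀) :
    IsHubbardGHFGroundState ((U₀ / 2 : ℂ) • (1 : Matrix (Fin 2) (Fin 2) ℂ)) (fun _ => U₀)
      offSiteWitness :=
  ⟨offSiteWitness_isAdmissible, fun _ hΓ' => by
    rw [hubbardGHFEnergy_offSiteWitness]
    exact hubbardGHFEnergy_atomicOnset_ge hU₀ hΓ'⟩

end Audit

/-- **DEPRECATED (verdict clean-up 2026-08-16) — MISSTATED, and REFUTED in this file: not a named
fact awaiting discharge, and NOT a catalogue entry (no barrier fields). The `Prop` is FALSE; it is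
kept, statement byte-for-byte under its ledger-referenced name, only because its refutation
`not_allHubbardGHFGroundStatesNormal` (the next declaration) names it.** What is wrong: "Every gHF
ground state of a strictly repulsive Hubbard model (`U_x > 0` for all `x`, any hopping matrix) is
a normal state" transplants the STRICT clause of Theorem 2.11 — printed only for `V` "strictly
positive (i.e., positive definite)" ("then any ground state (if it exists) must be a normal
state", p. 14) — to the Hubbard on-site interaction, which is merely positive SEMIdefinite and for
which §IV.a invokes only the semidefinite clause ("Theorem 2.11 applies. Hence, we may restrict our
attention to 1-pdm of the form `diag(γ, 1 - γ̄)`", p. 32); equivalently it claims that the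
certificate "a gHF ground state with `α ≠ 0`" is unavailable for `H_+`. It is refuted by
`not_allHubbardGHFGroundStatesNormal`: at the atomic band-bottom onset
`E(Γ) = U Σ_x {γ_↑γ_↓ - |γ_*|² + |α(x↑,x↓)|² + ¼} ≥ |Λ|U/4`, with equality iff every site block of
`γ` is singular and on-site pairing vanishes, and `γ = ½` on two `↑` orbitals with inter-site
`α = ½` attains it (`isHubbardGHFGroundState_offSiteWitness`). What survives is the barrier as
stated (`GeneralizedHartreeFockNoPairing`: ties only, clause (1); no on-site pairing, clause (5);
no energetic preference, clause (3)) and normality whenever the normal HF ground states are Slater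
determinants (`isNormal_of_isHubbardGHFGroundState_of_slater`, audit part 2; e.g. `μ = 0`,
bipartite `t`, by uniqueness modulo gauge transformations). Routes must therefore not be refused on
the ground that "a quasi-free ground state of the repulsive model cannot have `α ≠ 0`": it can
(off-site, equal-spin or any amplitude orthogonal to the on-site singlet channel), but only at
energy EQUAL to the normal infimum, and only at shell degeneracies. Being false, this `Prop` has NO
discharge `_holds`. USE INSTEAD the corrected statements (third audit section below, all
discharged): `AllHubbardGHFGroundStatesOnSiteNormal` (the same hypotheses — Hubbard, `U_x > 0`,
any `t` — with the conclusion the source supports: the ON-SITE amplitudes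
`α(x↑, x↓) = α(x↓, x↑) = 0` vanish), `GHFGroundStatesNormalOfTwoBodyPos` (Theorem 2.11's strict
clause AS PRINTED: positive DEFINITE `V` ⇒ every gHF ground state is normal) and
`AllHubbardGHFGibbsStatesNormal` (`0 < T < ∞`: every gHF Gibbs state of `H_+` is normal,
`U_x ≥ 0`).
[cite: BachLiebSolovej1994, Theorem 2.11 p. 14 (strict clause printed for positive definite V only) with §IV.a p. 32 (semidefinite clause), Theorem 4.5, Table 2 p. 39 and Table 3 p. 40] -/
@[deprecated "misstated and refuted as stated (BLS Theorem 2.11's strict clause requires a positive \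
DEFINITE V; the Hubbard on-site V is only positive semidefinite): see \
Literature.Barriers.HubbardSuperconductivity.not_allHubbardGHFGroundStatesNormal (this file); corrected \
statements, all discharged in this file: \
Literature.Barriers.HubbardSuperconductivity.AllHubbardGHFGroundStatesOnSiteNormal (same hypotheses, on-site \
amplitudes vanish), Literature.Barriers.HubbardSuperconductivity.GHFGroundStatesNormalOfTwoBodyPos (strict \
clause as printed, positive definite V), \
Literature.Barriers.HubbardSuperconductivity.AllHubbardGHFGibbsStatesNormal (positive temperature)" (since := "2026-08-16")]
def AllHubbardGHFGroundStatesNormal : Prop :=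
  ∀ {Λ : Type u} [Fintype Λ] [DecidableEq Λ] (t : Matrix Λ Λ ℂ) (U : Λ → ℝ), (∀ x, 0 < U x) →
    ∀ Γ : GHFState (Λ × Fin 2), IsHubbardGHFGroundState t U Γ → Γ.IsNormal

-- names the `@[deprecated]` record `AllHubbardGHFGroundStatesNormal` on purpose: this IS its refutation
-- (verdict clean-up 2026-08-16; the record is kept, so `linter.deprecated` is switched off for this theorem alone)
set_option linter.deprecated false in
/-- **Refutation of the over-reading** (the deprecated record `AllHubbardGHFGroundStatesNormal`,
kept as the target of this theorem): the two-site repulsive Hubbard model (`U ≡ 1`, `t = ½·1`)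
has a gHF ground state with nonzero (inter-site, equal-spin) pairing matrix.
[cite: BachLiebSolovej1994, Table 2 p. 39 (row μ ≠ 0) and Table 3 p. 40 (row any μ), left at "No results except for U = ∞"] -/
theorem not_allHubbardGHFGroundStatesNormal : ¬ AllHubbardGHFGroundStatesNormal.{0} := by
  intro h
  have h1 := isHubbardGHFGroundState_offSiteWitness (U₀ := 1) zero_le_one
  exact offSiteWitness_not_isNormal (h _ _ (fun _ => zero_lt_one) _ h1)

/-! ### Audit, part 2: when the loophole closes

A paired gHF ground state of `H_+` forces its normal part `Γ̃ = (γ, 0)` to be a ground state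
(Theorem 2.11) that is NOT a Slater determinant: an admissible 1-pdm whose `γ` is a projection
has `α = 0` (projections are extreme points of `{0 ≤ Γ ≤ 1}` and `Γ̃ = ½Γ + ½DΓD⋆`). Hence the
certificate "gHF ground state with `α ≠ 0`" is unavailable whenever the normal HF ground states
have closed shells (`γ² = γ`) — e.g. at half filling on a bipartite lattice, where the HF ground
state is unique modulo gauge transformations and gapped [cite: BachLiebSolovej1994, Theorem 4.5 and Lemma 4.2] —
and available only at shell degeneracies of the kind exhibited by `offSiteWitness` (the Hubbard
`V` is not strictly positive, so Theorem 2.12's "any HF minimizer must be a projection" does not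
apply either). Non-minimising stationary points are not constrained at all: the self-consistent
(Bogoliubov–de Gennes) equations of the bare `H_+` do have paired solutions — the gHF MAXIMISERS
of `H_+` are the BCS minimisers of the attractive model `-H_+` — so "self-consistent gap equation
with bare `U`" is covered by the barrier exactly for (energy- or pressure-) minimising solutions.
-/

namespace GHFState

variable {ι : Type u} [Fintype ι] [DecidableEq ι]

omit [Fintype ι] [DecidableEq ι] in
/-- A positive semidefinite block matrix with vanishing upper-left block has vanishing
off-diagonal blocks. [folklore] -/
theorem fromBlocks_offDiag_eq_zero_of_posSemidef {B : Matrix ι ι ℂ} {C : Matrix ι ι ℂ}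
    {D : Matrix ι ι ℂ} (h : (fromBlocks (0 : Matrix ι ι ℂ) B C D).PosSemidef) : B = 0 := by
  ext i j
  have hM := h.submatrix ![Sum.inl i, Sum.inr j]
  have hdet := hM.det_nonneg
  rw [Matrix.det_fin_two] at hdet
  have hH := h.1
  have hCB : C j i = star (B i j) := by
    have := hH.apply (Sum.inr j) (Sum.inl i)
    simpa [fromBlocks_apply₂₁, fromBlocks_apply₁₂] using this.symm
  simp only [submatrix_apply, Matrix.cons_val_zero, Matrix.cons_val_one,
    fromBlocks_apply₁₁, fromBlocks_apply₁₂, fromBlocks_apply₂₁, fromBlocks_apply₂₂,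
    Matrix.zero_apply, zero_mul, zero_sub] at hdet
  rw [hCB, Complex.star_def, Complex.mul_conj, Complex.normSq_eq_norm_sq] at hdet
  have h' : (0 : ℂ) ≤ ((-(‖B i j‖ ^ 2) : ℝ) : ℂ) := by push_cast; simpa using hdet
  have := Complex.zero_le_real.1 h'
  have h2 : ‖B i j‖ ^ 2 = 0 := le_antisymm (by linarith) (sq_nonneg _)
  simpa using h2

/-- **A quasi-free state whose `γ` is a projection has no pairing**: for an admissible 1-pdm
`Γ = (γ, α)` with `γ² = γ`, `α = 0` (projections are extreme points of `{0 ≤ Γ ≤ 1}`: compressing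
`0 ≤ Γ` by `diag(1 - γ, 1)` and `0 ≤ 1 - Γ` by `diag(γ, 1)` leaves positive block matrices with
zero corner, whence `(1 - γ)α = 0` and `γα = 0`). [folklore] -/
theorem isNormal_of_isAdmissible_of_γ_mul_self {Γ : GHFState ι} (hΓ : Γ.IsAdmissible)
    (hp : Γ.γ * Γ.γ = Γ.γ) : Γ.IsNormal := by
  obtain ⟨hγ, hαT, h0, h1⟩ := hΓ
  have hγ' : Γ.γᴴ = Γ.γ := hγ
  -- compress `0 ≤ Γ` by `B₁ = diag(1 - γ, 1)`
  set B₁ : Matrix (ι ⊕ ι) (ι ⊕ ι) ℂ := fromBlocks (1 - Γ.γ) 0 0 1 with hB₁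
  have hB₁H : B₁ᴴ = B₁ := by
    rw [hB₁, fromBlocks_conjTranspose]
    simp [conjTranspose_sub, hγ']
  have hc1 : (B₁ᴴ * Γ.onePDM * B₁).PosSemidef := h0.conjTranspose_mul_mul_same B₁
  have e1 : B₁ᴴ * Γ.onePDM * B₁ =
      fromBlocks 0 ((1 - Γ.γ) * Γ.α) (Γ.αᴴ * (1 - Γ.γ)) (1 - Γ.γᵀᴴ) := by
    rw [hB₁H, hB₁, onePDM, fromBlocks_multiply, fromBlocks_multiply]
    have hq : (1 - Γ.γ) * Γ.γ * (1 - Γ.γ) = 0 := by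
      rw [sub_mul, one_mul, hp, sub_self, zero_mul]
    congr 1 <;> simp [hq]
  rw [e1] at hc1
  have hA : (1 - Γ.γ) * Γ.α = 0 := fromBlocks_offDiag_eq_zero_of_posSemidef hc1
  -- compress `0 ≤ 1 - Γ` by `B₂ = diag(γ, 1)`
  set B₂ : Matrix (ι ⊕ ι) (ι ⊕ ι) ℂ := fromBlocks Γ.γ 0 0 1 with hB₂
  have hB₂H : B₂ᴴ = B₂ := by
    rw [hB₂, fromBlocks_conjTranspose]
    simp [hγ']
  have hc2 : (B₂ᴴ * (1 - Γ.onePDM) * B₂).PosSemidef := h1.conjTranspose_mul_mul_same B₂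
  have hone : (1 : Matrix (ι ⊕ ι) (ι ⊕ ι) ℂ) - Γ.onePDM =
      fromBlocks (1 - Γ.γ) (-Γ.α) (-Γ.αᴴ) Γ.γᵀᴴ := by
    rw [onePDM, ← fromBlocks_one, sub_eq_add_neg, fromBlocks_neg, fromBlocks_add]
    simp [sub_eq_add_neg]
  have e2 : B₂ᴴ * (1 - Γ.onePDM) * B₂ =
      fromBlocks 0 (-(Γ.γ * Γ.α)) (-(Γ.αᴴ * Γ.γ)) Γ.γᵀᴴ := by
    rw [hB₂H, hB₂, hone, fromBlocks_multiply, fromBlocks_multiply]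
    have hq : Γ.γ * (1 - Γ.γ) * Γ.γ = 0 := by
      rw [mul_sub, mul_one, hp, sub_self, zero_mul]
    congr 1 <;> simp [hq]
  rw [e2] at hc2
  have hB : -(Γ.γ * Γ.α) = 0 := fromBlocks_offDiag_eq_zero_of_posSemidef hc2
  have hB' : Γ.γ * Γ.α = 0 := neg_eq_zero.1 hB
  -- assemble
  have : Γ.α = (1 - Γ.γ) * Γ.α + Γ.γ * Γ.α := by rw [sub_mul, one_mul, sub_add_cancel]
  rw [IsNormal, this, hA, hB', add_zero]

end GHFState

section
open GHFState
variable {Λ : Type u} [Fintype Λ] [DecidableEq Λ]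

/-- **When the loophole closes.** If every NORMAL gHF ground state of a repulsive Hubbard model
(`U_x ≥ 0`) is a Slater determinant (`γ² = γ`: closed shells), then EVERY gHF ground state is
normal — the normal part of a ground state is a ground state (Theorem 2.11), hence pure by
hypothesis, and a quasi-free state with idempotent `γ` carries no pairing. [folklore] -/
theorem isNormal_of_isHubbardGHFGroundState_of_slater (t : Matrix Λ Λ ℂ) {U : Λ → ℝ}
    (hU : ∀ x, 0 ≤ U x)
    (hS : ∀ Γ : GHFState (Λ × Fin 2), IsHubbardGHFGroundState t U Γ → Γ.IsNormal →
      Γ.γ * Γ.γ = Γ.γ)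
    {Γ : GHFState (Λ × Fin 2)} (hΓ : IsHubbardGHFGroundState t U Γ) : Γ.IsNormal := by
  have hN := isHubbardGHFGroundState_normalPart t hU hΓ
  have hp := hS _ hN (isNormal_normalPart Γ)
  rw [normalPart_γ] at hp
  exact isNormal_of_isAdmissible_of_γ_mul_self hΓ.1 hp

end

/-! ### Audit, part 3 (2026-08-15, provefact pass on `AllHubbardGHFGroundStatesNormal`): the corrected statements, and positive temperature

`AllHubbardGHFGroundStatesNormal` is refuted above (`not_allHubbardGHFGroundStatesNormal`), so it
admits no discharge `AllHubbardGHFGroundStatesNormal_holds`. It MIS-STATES the source: Theorem 2.11's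
strict clause is printed for a STRICTLY positive (positive definite) `V` only ("Moreover, if `V` is
strictly positive (i.e., positive definite) then any ground state (if it exists) must be a normal
state", p. 14), while the Hubbard on-site `V` is merely positive semidefinite, and for it §IV.a
invokes only the semidefinite clause ("Theorem 2.11 applies. Hence, we may restrict our attention
to 1-pdm of the form `diag(γ, 1 - γ̄)`", p. 32). What the source prints, and what is true, is
recorded here under NEW names, each discharged:
* `GHFGroundStatesNormalOfTwoBodyPos` — the strict clause AS PRINTED (positive definite `V` ⇒
  every gHF ground state is normal; `_holds` = `GHFState.isNormal_of_isGroundState`);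
* `AllHubbardGHFGroundStatesOnSiteNormal` — its Hubbard form: for `U_x > 0` every gHF ground
  state has vanishing ON-SITE pairing amplitudes `α(x↑, x↓) = α(x↓, x↑) = 0`, the only amplitudes
  the functional (3a.7) contains (`_holds` = `onSitePairing_eq_zero_of_isHubbardGHFGroundState`);
* `AllHubbardGHFGibbsStatesNormal` — at POSITIVE temperature the over-reading becomes TRUE, and
  for every `U_x ≥ 0` (even `U ≡ 0`): every gHF Gibbs state ("A HF Gibbs state is defined by a
  1-pdm maximizing (2c.11)", p. 12; here: admissible minimisers of `-P_{β,μ}` (3a.8), `0 < β`,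
  i.e. `0 < T < ∞`, any `μ`) is normal, off-site amplitudes included. Mechanism, proved below:
  the entropy step (2c.32) is STRICT, `S(Γ̃) > S(Γ)` whenever `α ≠ 0`
  (`GHFState.entropy_lt_entropy_normalPart`), because `η` is strictly concave — equality in the
  eigenvalue form of Jensen forces every eigenvector of `Γ̃` to be an eigenvector of `Γ` with the
  same eigenvalue, i.e. `Γ = Γ̃` (`GHFState.eq_of_sum_binEntropy_eigenvalues_eq`); BLS use this
  equality case themselves in (3b.9) ("concavity of `S` implies ... with equality if and only if
  `Γ̂ = Γ̃`", p. 18). General form for any positive semidefinite `V`: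
  `GHFState.isNormal_of_isGibbsState`. Non-vacuity: Gibbs states exist (e.g.
  `isHubbardGHFGibbsState_maximallyMixed`: with `t = 0`, `U = 0`, `μ = 0` the maximally mixed
  1-pdm `Γ = ½` is a Gibbs state at every `β > 0`).
-/

namespace GHFState

variable {ι : Type u} [Fintype ι] [DecidableEq ι]

/-- **Equality in the averaging inequality forces `Γ = N`** (the equality case behind (2c.32)). In
the setting of `sum_binEntropy_eigenvalues_le_of_two_smul_eq` — `0 ≤ Γ ≤ 1`, `D` unitary, `N`
Hermitian with `2N = Γ + DΓD⋆` — if `Σ_j η(λ_j(Γ)) = Σ_i η(λ_i(N))` then `Γ = N`. Proof: with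
`Γ = U diag(μ) U⋆`, `N = V diag(ν) V⋆`, `W₁ = U⋆V`, `W₂ = U⋆D⋆V` and the doubly stochastic weights
`w_{ij} = ½(|W₁{}_{ji}|² + |W₂{}_{ji}|²)` one has `ν_i = Σ_j w_{ij} μ_j`; summing Jensen
`Σ_j w_{ij} η(μ_j) ≤ η(ν_i)` over `i` gives the inequality, so equality forces equality in each
Jensen step, and the equality case for the strictly concave `η` (Mathlib
`StrictConcaveOn.map_sum_eq_iff_of_nonneg`, `Real.strictConcave_binEntropy`) gives `μ_j = ν_i`
whenever `w_{ij} ≠ 0`, in particular whenever `W₁{}_{ji} ≠ 0`; hence `diag(μ) W₁ = W₁ diag(ν)`,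
i.e. `Γ V = V diag(ν)`, i.e. `Γ = N`.
[cite: BachLiebSolovej1994, (2c.32) and (3b.9) ("with equality if and only if")] -/
theorem eq_of_sum_binEntropy_eigenvalues_eq {m : Type*} [Fintype m] [DecidableEq m]
    {Γ D N : Matrix m m ℂ} (h0 : Γ.PosSemidef) (h1 : (1 - Γ).PosSemidef)
    (hD : D ∈ Matrix.unitaryGroup m ℂ) (hN : N.IsHermitian)
    (hNdef : (2 : ℂ) • N = Γ + D * Γ * star D)
    (heq : ∑ j, Real.binEntropy (h0.1.eigenvalues j) = ∑ i, Real.binEntropy (hN.eigenvalues i)) :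
    Γ = N := by
  -- spectral data
  set μ : m → ℝ := h0.1.eigenvalues with hμdef
  set ν : m → ℝ := hN.eigenvalues with hνdef
  set U : Matrix m m ℂ := (h0.1.eigenvectorUnitary : Matrix m m ℂ) with hUdef
  set V : Matrix m m ℂ := (hN.eigenvectorUnitary : Matrix m m ℂ) with hVdef
  have hUU : star U * U = 1 := Unitary.coe_star_mul_self _
  have hUU' : U * star U = 1 := Unitary.coe_mul_star_self _
  have hVV : star V * V = 1 := Unitary.coe_star_mul_self _
  have hVV' : V * star V = 1 := Unitary.coe_mul_star_self _
  have hDD : star D * D = 1 := Matrix.mem_unitaryGroup_iff'.1 hD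
  have hDD' : D * star D = 1 := Matrix.mem_unitaryGroup_iff.1 hD
  have hΓspec : Γ = U * diagonal (fun j => (μ j : ℂ)) * star U := by
    have := h0.1.spectral_theorem
    rw [Unitary.conjStarAlgAut_apply] at this
    exact this
  have hNspec : N = V * diagonal (fun j => (ν j : ℂ)) * star V := by
    have := hN.spectral_theorem
    rw [Unitary.conjStarAlgAut_apply] at this
    exact this
  -- the two unitaries
  set W₁ : Matrix m m ℂ := star U * V with hW₁
  set W₂ : Matrix m m ℂ := star U * star D * V with hW₂
  have hW₁u : W₁ᴴ * W₁ = 1 := by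
    rw [hW₁, ← star_eq_conjTranspose, star_mul, star_star, Matrix.mul_assoc,
      ← Matrix.mul_assoc U, hUU', Matrix.one_mul, hVV]
  have hW₁u' : W₁ * W₁ᴴ = 1 := by
    rw [hW₁, ← star_eq_conjTranspose, star_mul, star_star, Matrix.mul_assoc,
      ← Matrix.mul_assoc V, hVV', Matrix.one_mul, hUU]
  have hW₂u : W₂ᴴ * W₂ = 1 := by
    rw [hW₂, ← star_eq_conjTranspose, star_mul, star_mul, star_star, star_star, Matrix.mul_assoc,
      Matrix.mul_assoc, ← Matrix.mul_assoc U, ← Matrix.mul_assoc U, hUU', Matrix.one_mul,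
      ← Matrix.mul_assoc D, hDD', Matrix.one_mul, hVV]
  have hW₂u' : W₂ * W₂ᴴ = 1 := by
    rw [hW₂, ← star_eq_conjTranspose, star_mul, star_mul, star_star, star_star, Matrix.mul_assoc,
      Matrix.mul_assoc, ← Matrix.mul_assoc V, hVV', Matrix.one_mul, ← Matrix.mul_assoc (star D),
      hDD, Matrix.one_mul, hUU]
  -- `V⋆ N V = diag(ν)` and `2 V⋆ N V = W₁ᴴ diag(μ) W₁ + W₂ᴴ diag(μ) W₂`
  have hdiagN : star V * N * V = diagonal (fun j => (ν j : ℂ)) := by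
    calc star V * N * V = (star V * V) * diagonal (fun j => (ν j : ℂ)) * (star V * V) := by
          rw [hNspec]; noncomm_ring
      _ = diagonal (fun j => (ν j : ℂ)) := by rw [hVV, Matrix.one_mul, Matrix.mul_one]
  have hsplit : (2 : ℂ) • (star V * N * V) =
      W₁ᴴ * (diagonal (fun j => (μ j : ℂ)) * W₁) + W₂ᴴ * (diagonal (fun j => (μ j : ℂ)) * W₂) := by
    rw [← Matrix.smul_mul, ← Matrix.mul_smul, hNdef, hΓspec, hW₁, hW₂, ← star_eq_conjTranspose,
      ← star_eq_conjTranspose, star_mul, star_star, star_mul, star_mul, star_star, star_star]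
    noncomm_ring
  -- entrywise: `2 ν_i = Σ_j μ_j ‖W₁ji‖² + Σ_j μ_j ‖W₂ji‖²`
  have hνi : ∀ i, 2 * ν i = ∑ j, μ j * ‖W₁ j i‖ ^ 2 + ∑ j, μ j * ‖W₂ j i‖ ^ 2 := by
    intro i
    have h := congrFun (congrFun hsplit i) i
    rw [Matrix.smul_apply, hdiagN, diagonal_apply_eq, Matrix.add_apply,
      conjTranspose_mul_diagonal_mul_apply_self, conjTranspose_mul_diagonal_mul_apply_self,
      smul_eq_mul] at h
    have h' : ((2 * ν i : ℝ) : ℂ) =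
        ((∑ j, μ j * ‖W₁ j i‖ ^ 2 + ∑ j, μ j * ‖W₂ j i‖ ^ 2 : ℝ) : ℂ) := by
      push_cast at h ⊢
      exact h
    exact_mod_cast h'
  -- the doubly stochastic weights `w i j = ½(‖W₁ji‖² + ‖W₂ji‖²)`
  set w : m → m → ℝ := fun i j => (‖W₁ j i‖ ^ 2 + ‖W₂ j i‖ ^ 2) / 2 with hw
  have hw0 : ∀ i j, 0 ≤ w i j := fun i j => by positivity
  have hwcol : ∀ i, ∑ j, w i j = 1 := by
    intro i
    have h₁ := sum_sq_norm_col_eq_one hW₁u i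
    have h₂ := sum_sq_norm_col_eq_one hW₂u i
    simp only [hw]
    rw [← Finset.sum_div, Finset.sum_add_distrib, h₁, h₂]
    norm_num
  have hwrow : ∀ j, ∑ i, w i j = 1 := by
    intro j
    have h₁ := sum_sq_norm_row_eq_one hW₁u' j
    have h₂ := sum_sq_norm_row_eq_one hW₂u' j
    simp only [hw]
    rw [← Finset.sum_div, Finset.sum_add_distrib, h₁, h₂]
    norm_num
  have hνw : ∀ i, ν i = ∑ j, w i j * μ j := by
    intro i
    have h2 := hνi i
    have : ∑ j, w i j * μ j = (∑ j, μ j * ‖W₁ j i‖ ^ 2 + ∑ j, μ j * ‖W₂ j i‖ ^ 2) / 2 := by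
      rw [← Finset.sum_add_distrib, Finset.sum_div]
      refine Finset.sum_congr rfl fun j _ => ?_
      simp only [hw]
      ring
    rw [this]
    linarith
  have hμI : ∀ j, μ j ∈ Set.Icc (0 : ℝ) 1 := eigenvalues_mem_Icc_of_posSemidef h0 h1
  -- Jensen for each `i`; summed over `i` it is an equality, hence an equality termwise
  have hJ : ∀ i, ∑ j, w i j * Real.binEntropy (μ j) ≤ Real.binEntropy (ν i) := fun i => by
    rw [hνw i]
    exact sum_mul_binEntropy_le (hw0 i) (hwcol i) hμI
  have hswap : ∑ i, ∑ j, w i j * Real.binEntropy (μ j) = ∑ j, Real.binEntropy (μ j) := by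
    rw [Finset.sum_comm]
    refine Finset.sum_congr rfl fun j _ => ?_
    rw [← Finset.sum_mul, hwrow j, one_mul]
  have hsum0 : ∑ i, (Real.binEntropy (ν i) - ∑ j, w i j * Real.binEntropy (μ j)) = 0 := by
    rw [Finset.sum_sub_distrib, hswap]
    linarith
  have hterm : ∀ i, Real.binEntropy (∑ j, w i j * μ j) = ∑ j, w i j * Real.binEntropy (μ j) := by
    intro i
    have h := (Finset.sum_eq_zero_iff_of_nonneg fun i _ => sub_nonneg.2 (hJ i)).1 hsum0 i
      (Finset.mem_univ i)
    rw [← hνw i]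
    linarith
  -- the equality case of Jensen: `μ_j = ν_i` whenever `w i j ≠ 0`
  have hμν : ∀ i j, w i j ≠ 0 → μ j = ν i := by
    intro i j hij
    have hE := (Real.strictConcave_binEntropy.map_sum_eq_iff_of_nonneg (t := Finset.univ)
      (w := w i) (p := μ) (fun j _ => hw0 i j) (hwcol i) (fun j _ => hμI j)).1
      (by simpa only [smul_eq_mul] using hterm i)
    have hcalc : ν i = ∑ k, w i k * μ j := by
      rw [hνw i]
      refine Finset.sum_congr rfl fun k _ => ?_
      by_cases hk : w i k = 0
      · rw [hk, zero_mul, zero_mul]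
      · rw [hE (Finset.mem_univ k) hk (Finset.mem_univ j) hij]
    rw [hcalc, ← Finset.sum_mul, hwcol i, one_mul]
  -- hence `diag(μ) W₁ = W₁ diag(ν)`
  have hcomm : diagonal (fun j => (μ j : ℂ)) * W₁ = W₁ * diagonal (fun i => (ν i : ℂ)) := by
    ext j i
    rw [diagonal_mul, mul_diagonal]
    by_cases hne : W₁ j i = 0
    · rw [hne, mul_zero, zero_mul]
    · have hpos : 0 < w i j := by
        have h1 : 0 < ‖W₁ j i‖ ^ 2 := by positivity
        have h2 : 0 ≤ ‖W₂ j i‖ ^ 2 := sq_nonneg _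
        simp only [hw]
        linarith
      rw [hμν i j hpos.ne', mul_comm]
  -- and `Γ = U diag(μ) U⋆ V V⋆ = U W₁ diag(ν) V⋆ = V diag(ν) V⋆ = N`
  calc Γ = U * (diagonal (fun j => (μ j : ℂ)) * W₁) * star V := by
        rw [hW₁]
        calc Γ = Γ * (V * star V) := by rw [hVV', Matrix.mul_one]
          _ = _ := by rw [hΓspec]; noncomm_ring
    _ = U * (W₁ * diagonal (fun i => (ν i : ℂ))) * star V := by rw [hcomm]
    _ = (U * star U) * (V * diagonal (fun i => (ν i : ℂ)) * star V) := by
        rw [hW₁]; noncomm_ring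
    _ = N := by rw [hUU', Matrix.one_mul, ← hNspec]

/-- **The entropy step (2c.32) is strict:** for an admissible 1-pdm with `α ≠ 0`,
`S(Γ) < S(Γ̃)` — `Γ̃ = ½Γ + ½Γ'` with `Γ' = DΓD⋆ ≠ Γ`, and the entropy is strictly concave.
[cite: BachLiebSolovej1994, (2c.32) and (3b.9) ("concavity of S implies ... with equality if and only if")] -/
theorem entropy_lt_entropy_normalPart {Γ : GHFState ι} (hΓ : Γ.IsAdmissible) (hα : ¬ Γ.IsNormal) :
    Γ.entropy < Γ.normalPart.entropy := by
  have h0 : Γ.onePDM.PosSemidef := hΓ.2.2.1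
  have h1 : (1 - Γ.onePDM).PosSemidef := hΓ.2.2.2
  have hN : Γ.normalPart.onePDM.IsHermitian := (isAdmissible_normalPart hΓ).2.2.1.1
  rw [entropy_eq Γ h0.1, entropy_eq Γ.normalPart hN]
  refine mul_lt_mul_of_pos_left ?_ (by norm_num)
  refine lt_of_le_of_ne (sum_binEntropy_eigenvalues_le_of_two_smul_eq h0 h1
    paritySign_mem_unitaryGroup hN (two_smul_onePDM_normalPart Γ)) fun heq => hα ?_
  have hΓN := eq_of_sum_binEntropy_eigenvalues_eq h0 h1 paritySign_mem_unitaryGroup hN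
    (two_smul_onePDM_normalPart Γ) heq
  rw [onePDM_normalPart, onePDM] at hΓN
  exact (Matrix.fromBlocks_inj.1 hΓN).2.1

/-- For admissible `Γ`, `S(Γ) = S(Γ̃)` iff `Γ` is normal. [cite: BachLiebSolovej1994, (2c.32) and (3b.9)] -/
theorem entropy_eq_entropy_normalPart_iff {Γ : GHFState ι} (hΓ : Γ.IsAdmissible) :
    Γ.entropy = Γ.normalPart.entropy ↔ Γ.IsNormal := by
  refine ⟨fun h => ?_, fun h => by rw [normalPart_eq_self_of_isNormal h]⟩
  by_contra hα
  exact absurd h (entropy_lt_entropy_normalPart hΓ hα).ne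

/-- gHF Gibbs states at inverse temperature `β` and chemical potential `μ`: admissible 1-pdm's
minimising `-P_{β,μ}(Γ) = E(Γ) - β⁻¹S(Γ) - μN(Γ)` over all admissible 1-pdm's ("A HF Gibbs state
is defined by a 1-pdm maximizing (2c.11)").
[cite: BachLiebSolovej1994, (2c.11)–(2c.12) and the definition following them, p. 12] -/
def IsGibbsState (h : Matrix ι ι ℂ) (V : ι → ι → ι → ι → ℂ) (β μ : ℝ) (Γ : GHFState ι) : Prop :=
  Γ.IsAdmissible ∧ ∀ Γ' : GHFState ι, Γ'.IsAdmissible → negPressure h V β μ Γ ≤ negPressure h V β μ Γ'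

/-- **Strict pressure domination at positive temperature.** For positive (semi)definite `V`,
`0 < β < ∞` and any `μ`: if `α ≠ 0` then `-P_{β,μ}(Γ̃) < -P_{β,μ}(Γ)` (energy and particle number
do not increase, (2c.31); the entropy strictly increases, `entropy_lt_entropy_normalPart`). Derived
here. [cite: BachLiebSolovej1994, Theorem 2.11 (2c.29) with (2c.31)–(2c.32), and (3b.9)] -/
theorem negPressure_normalPart_lt {V : ι → ι → ι → ι → ℂ} (hV : TwoBodyNonneg V)
    (h : Matrix ι ι ℂ) {β : ℝ} (hβ : 0 < β) (μ : ℝ) {Γ : GHFState ι} (hΓ : Γ.IsAdmissible)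
    (hα : ¬ Γ.IsNormal) : negPressure h V β μ Γ.normalPart < negPressure h V β μ Γ := by
  unfold negPressure
  have hE := (Complex.le_def.1 (energy_normalPart_le hV h Γ)).1
  have hS := mul_lt_mul_of_pos_left (entropy_lt_entropy_normalPart hΓ hα) (inv_pos.2 hβ)
  simp only [normalPart_γ]
  linarith

/-- **Every gHF Gibbs state is normal (positive semidefinite `V`, `0 < T < ∞`).** For
`TwoBodyNonneg V`, `0 < β` and any `μ`, every admissible minimiser of `-P_{β,μ}` has `α = 0`: its
normal part is an admissible competitor of strictly smaller `-P` otherwise. (Strengthens the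
printed (2c.29), "`P^HF(β) = sup` over normal states", from SOME optimal state being normal to ALL;
derived here from the strict entropy step.)
[cite: BachLiebSolovej1994, Theorem 2.11 (2c.29), (2c.32) and (3b.9)] -/
theorem isNormal_of_isGibbsState {V : ι → ι → ι → ι → ℂ} (hV : TwoBodyNonneg V) {h : Matrix ι ι ℂ}
    {β : ℝ} (hβ : 0 < β) {μ : ℝ} {Γ : GHFState ι} (hΓ : IsGibbsState h V β μ Γ) : Γ.IsNormal := by
  by_contra hα
  exact absurd (hΓ.2 _ (isAdmissible_normalPart hΓ.1))
    (not_le.2 (negPressure_normalPart_lt hV h hβ μ hΓ.1 hα))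



/-- The entropy of any 1-pdm is at most `|ι| log 2` (`η ≤ log 2`, Mathlib `Real.binEntropy_le_log_two`;
`½ · 2|ι| · log 2`). [folklore] -/
theorem entropy_le_card_mul_log_two (Γ : GHFState ι) :
    Γ.entropy ≤ Fintype.card ι * Real.log 2 := by
  unfold entropy
  split_ifs with hΓ
  · calc (1 / 2 : ℝ) * ∑ i, Real.binEntropy (hΓ.eigenvalues i)
          ≤ (1 / 2 : ℝ) * ∑ _i : ι ⊕ ι, Real.log 2 :=
            mul_le_mul_of_nonneg_left (Finset.sum_le_sum fun i _ => Real.binEntropy_le_log_two)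
              (by norm_num)
      _ = Fintype.card ι * Real.log 2 := by
            rw [Finset.sum_const, Finset.card_univ, Fintype.card_sum, nsmul_eq_mul]
            push_cast
            ring
  · have := Real.log_pos (by norm_num : (1 : ℝ) < 2)
    positivity

/-- The maximally mixed 1-pdm `Γ = ½` on `H ⊕ H`: `γ = ½·1`, `α = 0`. [folklore] -/
def maximallyMixed (ι : Type u) [DecidableEq ι] : GHFState ι := ⟨(1 / 2 : ℂ) • 1, 0⟩

omit [Fintype ι] in
/-- `star (1/2) = 1/2` in `ℂ`, entrywise: `((½)·1)ᵀᴴ = (½)·1`. [folklore] -/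
theorem conjTranspose_transpose_half_smul_one :
    (((1 / 2 : ℂ) • (1 : Matrix ι ι ℂ))ᵀ)ᴴ = (1 / 2 : ℂ) • 1 := by
  ext i j
  by_cases hij : i = j
  · subst hij
    simp
  · simp [hij, Ne.symm hij]

/-- `1 - ½·1 = ½·1`. [folklore] -/
theorem one_sub_half_smul_one {m : Type*} [DecidableEq m] :
    (1 : Matrix m m ℂ) - (1 / 2 : ℂ) • 1 = (1 / 2 : ℂ) • 1 := by
  ext i j
  by_cases hij : i = j
  · subst hij
    simp
    norm_num
  · simp [hij]

omit [Fintype ι] in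
/-- The maximally mixed 1-pdm is `½·1` on `H ⊕ H`. [folklore] -/
theorem onePDM_maximallyMixed : (maximallyMixed ι).onePDM = (1 / 2 : ℂ) • 1 := by
  rw [maximallyMixed, onePDM, conjTranspose_transpose_half_smul_one, conjTranspose_zero,
    one_sub_half_smul_one, ← fromBlocks_one, fromBlocks_smul, smul_zero]

/-- `½·1` is positive semidefinite. [folklore] -/
theorem posSemidef_half_smul_one {m : Type*} [Fintype m] [DecidableEq m] :
    ((1 / 2 : ℂ) • (1 : Matrix m m ℂ)).PosSemidef :=
  Matrix.PosSemidef.one.smul (le_of_lt (by rw [one_div]; exact inv_pos.2 zero_lt_two))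

/-- The maximally mixed 1-pdm is admissible. [folklore] -/
theorem isAdmissible_maximallyMixed : (maximallyMixed ι).IsAdmissible := by
  refine ⟨?_, by simp [maximallyMixed], ?_, ?_⟩
  · have h := conjTranspose_transpose_half_smul_one (ι := ι)
    rw [transpose_smul, transpose_one] at h
    exact h
  · rw [onePDM_maximallyMixed]
    exact posSemidef_half_smul_one
  · rw [onePDM_maximallyMixed, one_sub_half_smul_one]
    exact posSemidef_half_smul_one

/-- The maximally mixed 1-pdm has the maximal entropy `|ι| log 2` (all `2|ι|` eigenvalues of `½·1`
are `½`, `η(½) = log 2`). [folklore] -/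
theorem entropy_maximallyMixed : (maximallyMixed ι).entropy = Fintype.card ι * Real.log 2 := by
  have hH : (maximallyMixed ι).onePDM.IsHermitian := isAdmissible_maximallyMixed.2.2.1.1
  rw [entropy_eq _ hH]
  have hev : ∀ i, hH.eigenvalues i = 1 / 2 := by
    intro i
    rw [hH.eigenvalues_eq i]
    set u : ι ⊕ ι → ℂ := ⇑(hH.eigenvectorBasis i) with hu
    have hunit : star u ⬝ᵥ u = 1 := by
      have hn := hH.eigenvectorBasis.orthonormal.1 i
      have hin : inner ℂ (hH.eigenvectorBasis i) (hH.eigenvectorBasis i) = (1 : ℂ) := by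
        rw [inner_self_eq_norm_sq_to_K, hn]
        simp
      rw [EuclideanSpace.inner_eq_star_dotProduct, dotProduct_comm] at hin
      exact hin
    have hA : (maximallyMixed ι).onePDM *ᵥ u = (1 / 2 : ℂ) • u := by
      rw [onePDM_maximallyMixed, smul_mulVec, one_mulVec]
    rw [hA, dotProduct_smul, hunit]
    simp
  simp_rw [hev]
  rw [Finset.sum_const, Finset.card_univ, Fintype.card_sum]
  have : Real.binEntropy (1 / 2) = Real.log 2 := by
    rw [one_div]; exact Real.binEntropy_two_inv
  rw [this, nsmul_eq_mul]
  push_cast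
  ring

end GHFState

section HubbardPositiveTemperature

open GHFState

variable {Λ : Type u} [Fintype Λ] [DecidableEq Λ]

/-- gHF Gibbs states of the repulsive Hubbard model at inverse temperature `β` and chemical
potential `μ`: admissible minimisers of `-P_{β,μ}(Γ) = E(Γ) - β⁻¹S(Γ) - μ Tr γ` (3a.8) over all
admissible 1-pdm's ("A HF Gibbs state is defined by a 1-pdm maximizing (2c.11)").
[cite: BachLiebSolovej1994, (3a.8)–(3a.9) with (4a.1), and p. 12] -/
def IsHubbardGHFGibbsState (t : Matrix Λ Λ ℂ) (U : Λ → ℝ) (β μ : ℝ) (Γ : GHFState (Λ × Fin 2)) :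
    Prop :=
  Γ.IsAdmissible ∧ ∀ Γ' : GHFState (Λ × Fin 2), Γ'.IsAdmissible →
    hubbardGHFNegPressure t U β μ Γ ≤ hubbardGHFNegPressure t U β μ Γ'

/-- **Strict pressure domination for the repulsive Hubbard model at `0 < T < ∞`:** for `U_x ≥ 0`,
`0 < β`, any `t` and `μ`, an admissible 1-pdm with `α ≠ 0` has `-P_{β,μ}(Γ̃) < -P_{β,μ}(Γ)`.
Derived here. [cite: BachLiebSolovej1994, Theorem 2.11 (2c.29), (2c.32), (3b.9) and §IV.a] -/
theorem hubbardGHFNegPressure_normalPart_lt (t : Matrix Λ Λ ℂ) {U : Λ → ℝ} (hU : ∀ x, 0 ≤ U x)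
    {β : ℝ} (hβ : 0 < β) (μ : ℝ) {Γ : GHFState (Λ × Fin 2)} (hΓ : Γ.IsAdmissible)
    (hα : ¬ Γ.IsNormal) :
    hubbardGHFNegPressure t U β μ Γ.normalPart < hubbardGHFNegPressure t U β μ Γ := by
  unfold hubbardGHFNegPressure
  have hE := hubbardGHFEnergy_normalPart_le t hU Γ
  have hS := mul_lt_mul_of_pos_left (entropy_lt_entropy_normalPart hΓ hα) (inv_pos.2 hβ)
  simp only [normalPart_γ]
  linarith

/-- **Every gHF Gibbs state of the repulsive Hubbard model is normal** (`U_x ≥ 0`, `0 < β`, any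
hopping matrix and chemical potential; off-site pairing amplitudes included). Derived here.
[cite: BachLiebSolovej1994, Theorem 2.11 (2c.29), (2c.32), (3b.9) and §IV.a; p. 3 ("always has a normal state as its optimal state (for zero and for positive temperature)")] -/
theorem isNormal_of_isHubbardGHFGibbsState (t : Matrix Λ Λ ℂ) {U : Λ → ℝ} (hU : ∀ x, 0 ≤ U x)
    {β : ℝ} (hβ : 0 < β) {μ : ℝ} {Γ : GHFState (Λ × Fin 2)}
    (hΓ : IsHubbardGHFGibbsState t U β μ Γ) : Γ.IsNormal := by
  by_contra hα
  exact absurd (hΓ.2 _ (isAdmissible_normalPart hΓ.1))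
    (not_le.2 (hubbardGHFNegPressure_normalPart_lt t hU hβ μ hΓ.1 hα))

end HubbardPositiveTemperature

section NonVacuity

open GHFState

variable {Λ : Type u} [Fintype Λ] [DecidableEq Λ]

omit [DecidableEq Λ] in
/-- With no hopping and no interaction the gHF energy vanishes identically. [folklore] -/
theorem hubbardGHFEnergy_zero_zero (Γ : GHFState (Λ × Fin 2)) :
    hubbardGHFEnergy (0 : Matrix Λ Λ ℂ) (fun _ => 0) Γ = 0 := by
  simp [hubbardGHFEnergy]

/-- **Non-vacuity of the positive-temperature statements: Gibbs states exist.** With `t = 0`,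
`U ≡ 0` and `μ = 0`, the maximally mixed 1-pdm `Γ = ½` is a gHF Gibbs state at every `0 < β`
(`-P_{β,0}(Γ') = -β⁻¹S(Γ') ≥ -β⁻¹|Λ × Fin 2| log 2 = -P_{β,0}(½)`). [folklore] -/
theorem isHubbardGHFGibbsState_maximallyMixed {β : ℝ} (hβ : 0 < β) :
    IsHubbardGHFGibbsState (0 : Matrix Λ Λ ℂ) (fun _ => 0) β 0 (maximallyMixed (Λ × Fin 2)) := by
  refine ⟨isAdmissible_maximallyMixed, fun Γ' _ => ?_⟩
  unfold hubbardGHFNegPressure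
  rw [hubbardGHFEnergy_zero_zero, hubbardGHFEnergy_zero_zero, entropy_maximallyMixed]
  have hS := entropy_le_card_mul_log_two Γ'
  have hb : 0 < β⁻¹ := inv_pos.2 hβ
  have := mul_le_mul_of_nonneg_left hS hb.le
  simp only [zero_mul, sub_zero, zero_sub, neg_le_neg_iff]
  exact this

end NonVacuity

/-- **Corrected statement 1 (Theorem 2.11, strict clause, AS PRINTED).** "Moreover, if `V` is
strictly positive (i.e., positive definite) then any ground state (if it exists) must be a normal
state": for every finite one-particle space, every one-body `h` and every two-body `V` whose form
(2c.30) is positive DEFINITE (`GHFState.TwoBodyPos`), every gHF ground state has `α = 0`. This is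
the hypothesis that the refuted over-reading `AllHubbardGHFGroundStatesNormal` drops (the Hubbard
`V` is only semidefinite). Discharged below (`GHFGroundStatesNormalOfTwoBodyPos_holds`).
[cite: BachLiebSolovej1994, Theorem 2.11 (strict clause), p. 14] -/
def GHFGroundStatesNormalOfTwoBodyPos : Prop :=
  ∀ {κ : Type u} [Fintype κ] [DecidableEq κ] (h : Matrix κ κ ℂ) (V : κ → κ → κ → κ → ℂ),
    GHFState.TwoBodyPos V → ∀ Γ : GHFState κ, GHFState.IsGroundState h V Γ → Γ.IsNormal

/-- **Discharge of `GHFGroundStatesNormalOfTwoBodyPos`** (= `GHFState.isNormal_of_isGroundState`).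
[cite: BachLiebSolovej1994, Theorem 2.11 (strict clause), p. 14] -/
theorem GHFGroundStatesNormalOfTwoBodyPos_holds : GHFGroundStatesNormalOfTwoBodyPos.{u} :=
  fun _h _V hV _Γ hΓ => GHFState.isNormal_of_isGroundState hV hΓ

/-- **Corrected statement 2 (the Hubbard form of the strict clause).** For a strictly repulsive
Hubbard model (`U_x > 0` for all `x`; any finite `Λ`, any hopping matrix `t`, any chemical
potential absorbed in `t`), every gHF ground state has vanishing ON-SITE pairing amplitudes,
`α(x↑, x↓) = α(x↓, x↑) = 0` for all `x` — the only pairing amplitudes the functional (3a.7)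
contains; off-site amplitudes are NOT forced to vanish (`not_allHubbardGHFGroundStatesNormal`).
Discharged below. [cite: BachLiebSolovej1994, Theorem 2.11 (strict clause) with (3a.7) and §IV.a (4a.1)–(4a.2)] -/
def AllHubbardGHFGroundStatesOnSiteNormal : Prop :=
  ∀ {Λ : Type u} [Fintype Λ] [DecidableEq Λ] (t : Matrix Λ Λ ℂ) (U : Λ → ℝ), (∀ x, 0 < U x) →
    ∀ Γ : GHFState (Λ × Fin 2), IsHubbardGHFGroundState t U Γ →
      ∀ x : Λ, Γ.α (x, 0) (x, 1) = 0 ∧ Γ.α (x, 1) (x, 0) = 0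

/-- **Discharge of `AllHubbardGHFGroundStatesOnSiteNormal`**
(= `onSitePairing_eq_zero_of_isHubbardGHFGroundState`).
[cite: BachLiebSolovej1994, Theorem 2.11 (strict clause) with (3a.7) and §IV.a] -/
theorem AllHubbardGHFGroundStatesOnSiteNormal_holds : AllHubbardGHFGroundStatesOnSiteNormal.{u} :=
  fun t _U hU _Γ hΓ x => onSitePairing_eq_zero_of_isHubbardGHFGroundState t hU hΓ x

/-- **Corrected statement 3 (positive temperature): every gHF Gibbs state of the repulsive Hubbard
model is normal.** For every finite `Λ`, hopping matrix `t`, `U_x ≥ 0`, inverse temperature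
`0 < β < ∞` and chemical potential `μ`, every admissible minimiser of the pressure functional
`-P_{β,μ}` (3a.8) has `α = 0` — off-site amplitudes included, and even for `U ≡ 0`. This is the
TRUE positive-temperature counterpart of the refuted `T = 0` over-reading
`AllHubbardGHFGroundStatesNormal`; it sharpens the printed (2c.29) ("`P^HF(β) = sup` over normal
states": SOME optimal state is normal) to ALL optimal states, by the strict form of the entropy
step (2c.32) (`GHFState.entropy_lt_entropy_normalPart`; the equality case of the concavity of `S`
that BLS invoke in (3b.9)). Derived here; discharged below (`AllHubbardGHFGibbsStatesNormal_holds`).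
[cite: BachLiebSolovej1994, Theorem 2.11 (2c.29) and (2c.32), (3b.9), §IV.a, and p. 3 ("for zero and for positive temperature")] -/
def AllHubbardGHFGibbsStatesNormal : Prop :=
  ∀ {Λ : Type u} [Fintype Λ] [DecidableEq Λ] (t : Matrix Λ Λ ℂ) (U : Λ → ℝ), (∀ x, 0 ≤ U x) →
    ∀ β μ : ℝ, 0 < β → ∀ Γ : GHFState (Λ × Fin 2), IsHubbardGHFGibbsState t U β μ Γ → Γ.IsNormal

/-- **Discharge of `AllHubbardGHFGibbsStatesNormal`.**
[cite: BachLiebSolovej1994, Theorem 2.11 (2c.29), (2c.32) and (3b.9)] -/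
theorem AllHubbardGHFGibbsStatesNormal_holds : AllHubbardGHFGibbsStatesNormal.{u} :=
  fun t _U hU _β _μ hβ _Γ hΓ => isNormal_of_isHubbardGHFGibbsState t hU hβ hΓ

end Literature.Barriers.HubbardSuperconductivity

end
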